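import Literature.NumberTheory.LFunctions.ProlateUniqueness
import Literature.NumberTheory.LFunctions.ProlateEigenvalueLegendreBounds
import HarnessLib

/-!
# Connes–Consani 2021, Appendix F «Issues of convergence»: convergence and remainder control of the
# series for `Qε` (Lemma F.1, Remark F.2 = arXiv running numbers Lemma 49, Remark 50), with the
# prolate inputs of [Wang 2010] it imports

RH-FREE corpus literature (label, line 1): real-analysis estimates on prolate spheroidal wave
functions at bandwidth `c = 2π`; nothing in this file mentions `ζ`, the critical strip or RH, and
nothing here bears on the truth of RH.  bears_on (cell rh-crit, corpus C1): apex input (B) «density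
of `E`» of `MainInequalityAssembly.weilArchPositivity_soninTrace_fine_of_spectralData` (the `C²`
regularity of `ε∘exp` is obtained in print from the termwise bounds of this appendix).

Source: A. Connes, C. Consani, *Weil positivity and trace formula, the archimedean place*, Selecta
Math. (N.S.) 27 (2021) 77 = arXiv:2006.13771 [bib `ConnesConsani2021`], Appendix F «Issues of
convergence» (tex label `appendix-cv`; PRINTED numbering Lemma F.1, Remark F.2, arXiv PDF p. 55 — cell
dictionary `cc/CC2021-NUMBERING-lit-1.md`; the held text `paper:arxiv-2006.13771` ignores
`\numberwithin` and prints the running numbers Lemma 49, Remark 50, which the decl names below keep as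
keys — `CC2021_lemma_49_*`, `CC2021_rem_50_*`, `IsAppEProlateDatum`; prose «Lemma 49 / Remark 50»
below = printed Lemma F.1 / Remark F.2; chunk locators `pNNNN:Lnn` refer to the held text, chunks
p0035–p0036).  Prolate inputs: L.-L. Wang, *Analysis of spectral approximations
using prolate spheroidal wave functions*, Math. Comp. 79 (2010) 807–827 [bib `WangLL2010`], Lemma 2.2
(eq. (2.6), p. 809) and Theorem 3.6 (eq. (3.43), p. 820); V. Rokhlin, H. Xiao, Appl. Comput. Harmon.
Anal. 22 (2007) 105–123 [bib `RokhlinXiao2007`], Theorems 12 and 14 (pp. 116–117).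

## What is printed (App. F, p0035:L1–p0036:L14)

With the objects of §4 (Prop. 4.5 = arXiv Prop. 25): `ξ_n = 𝒫₁φ_n/‖𝒫₁φ_n‖` the even prolate
function `PS_{2n,0}(2π,·)` cut off to `[−1,1]` and normalised in CC's inner product
`⟨η|ξ⟩ = ∫_0^∞ η̄ξ` (eq. (innerltwoeven) p. 6, so `∫_{-1}^1 ξ_n² = 2`), `η_n = 𝔽_{e_ℝ}ξ_n`,
`𝒫₁η_n = λ(n)ξ_n` ((chirem0.5)), `ζ_n = η_n/√(1−λ(n)²)` on `[1,∞)`, `D_u f(x) = x f′(x)`, and the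
terms `T_n(ρ)` of Prop. 5.3 (sonineQ) (p0020:L59–L64)
`T_n(ρ) = ρ^{1/2}∫_{ρ⁻¹}^1 (D_uξ_n)(x)(D_uζ_n)(ρx)dx + ρ^{-1/2}(D_uξ_n)(ρ⁻¹)ζ_n(1) − ρ^{1/2}ξ_n(1)(D_uζ_n)(ρ)`,
App. F sets `A_n(ρ) := τ(n)·(first term)`, `B_n(ρ) := τ(n)·(the two boundary terms)`,
`τ(n) = λ(n)/√(1−λ(n)²)`, proves (boundAn) (p0035:L45) and (boundBn) (p0035:L74) for `1 ≤ ρ ≤ 2`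
from Schwarz's inequality, `𝐖ξ_n = χ_{2n}^{2π}ξ_n`, [Wang] Thm 3.6 = (boundWang) (p0035:L37),
`χ_{2n}^{2π} ≤ 2n(2n+1)+(2π)²` ([Wang] (2.6)), (Rokh) `|ξ_n(1)| ≤ √(2n+½)` ([Rokhlin] Thm 12,
p0020:L98) and (chirem0.5), and concludes

* **Lemma 49** (p0035:L78–L85). `(i)` the series (sonineQ) converges and (computersafe)
  `|Qε(ρ) − Σ_0^N τ(k)T_k(ρ)| ≤ Σ_{N+1}^∞ a(n)`,
  `a(n) = 2^{2n+2} π^{2n+3/2} p(n) ((2n)!)² / ((4n)! Γ(2n+3/2))`,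
  `p(n) = 16n² + 8(1+3π)n + (4+√2)√(4n+1) + 32π² + 24π + 2`; `(ii)` (computersafe1) for `N = 10` the
  remainder is `≤ 2.366 × 10^{-12}` for every `ρ ∈ [1,2]`.  *Proof.* `(i)`: for `n ≥ 3`,
  `|τ(n)T_n(ρ)| ≤ 2λ(n)(|A_n(ρ)|+|B_n(ρ)|) ≤ a(n)` (display p0035:L88–L92, using (rapid-decay)
  `|λ(n)| ≤ 2^{2n}π^{2n+1/2}((2n)!)²/((4n)!Γ(2n+3/2))`, §4 p0016:L36 = [Rokhlin] Thm 14); `(ii)`: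
  `Σ_{11}^{34} a(n) ∼ 2.365 × 10^{-12}` "one then simply computes the missing terms" and
  `Σ_{35}^∞ a(n) ≤ 10^{-80}` by a geometric bound (p0035:L94–L110).
* **Remark 50** (p0036:L1–L14). For `f ∈ C^∞([−1,1],ℝ)`, `c = 2π`,
  `∫_{-1}^1 (𝐖f)² = ∫(1−x²)²|f″|² + 2∫(1−x²)(1+c²x²)|f′|² + c²∫(c²x⁴+6x²−2)|f|²` ([Wang] (3.26)),
  whence `∫_{-1}^1 (ξ_n″)²(1−x²)² ≤ ∫(𝐖ξ_n)² + 2c²∫ξ_n²` and the improvement of (boundWang)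
  `(∫_0^1 (ξ_n″)²(1−x²)²)^{1/2} ≤ √((χ_{2n}^{2π})²+2c²) ≤ 2n(2n+1) + (2π)²(1+√2)`.

## How it is typed (tree normalisation; cell rh-crit/cc ASSIGNMENTS §0 (B), routes-1 shape (S2))

The prolate datum is the TREE's `IsProlateFunction 1 (2n) ψ` (`Literature.NumberTheory.LFunctions`,
file `ConnesProlateGuess.lean`: `C²` on `[−1,1]`, zero outside, `∫_{-1}^1 ψ² = 1`, even with `2n`
zeros), i.e. `ψ = ±ξ_n/√2`; CC's `½`-inner product on even functions is absorbed by this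
normalisation exactly as in `ArchimedeanSoninTrace.scalingCoeff`: with `η̃ := cosTransform ψ = 𝔽_{e_ℝ}ψ
= η_n/√2` one has `ζ_n = √2 η̃/√(1−λ²)` on `[1,∞)` and
`τ(n)T_n(ρ) = (2λ/(1−λ²))·(ρ^{1/2}∫_{ρ⁻¹}^1 D_uψ · D_uη̃(ρ·) + ρ^{-1/2}D_uψ(ρ⁻¹)η̃(1) − ρ^{1/2}ψ(1)D_uη̃(ρ))`
`= sonineQTerm ψ λ ρ` (the factor `2 = ∫_{-1}^1ξ_n²`).  `D_u` on the cut-off `ξ`-side is taken with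
the one-sided derivative within `[−1,1]` (`scaleDerivIn`), as in Lemma 5.2 (= arXiv Lemma 29:
"`ξ ∈ C^∞((0,1])` extended by `0`"), so that the point value `(D_uξ_n)(ρ⁻¹)` at `ρ = 1` is the
printed one; on the smooth `η`-side it is `x·deriv` (`scaleDeriv`).  The eigenvalue `λ(n)` of the
truncated Fourier transform is NOT defined here (§4, Prop. 4.5 is typed by the §4 file of the cell):
it enters as a binder `lam` constrained by (chirem0.5) `cosTransform ψ = lam·ψ` on `[−1,1]`, and the
§4/prolate-literature inequalities App. F imports enter as the fields of `IsAppEProlateDatum`.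
`T_n`, `ε`, `Qε` themselves (Prop. 5.3, Lemma 5.4) belong to the §5 file; by Prop. 5.3
`Qε(ρ) − Σ_0^N τ(k)T_k(ρ) = Σ_{k>N} sonineQTerm ψ_k λ(k) ρ`, which is how (computersafe) is stated
below (`CC2021_lemma_49_i`).

* NAMED FACTS (unproved here): `CC2021_lemma_49_termwise` — the termwise majorisation
  `|τ(n)T_n(ρ)| ≤ a(n)` (`n ≥ 3`, `ρ ∈ [1,2]`) which is the content of the proof of Lemma 49 (i),
  RH-FREE real analysis, with the imported inequalities as hypotheses (dischargeable; see ERRATA for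
  why the (Rokh) field is the Rokhlin–Xiao form); `CC2021_lemma_49_ii_tail` — the number
  `Σ_{n≥11} a(n) ≤ 2.366·10^{-12}` (NUMERICAL IN PRINT; a decidable real inequality, margin `3·10^{-4}`);
  `Wang2010_lemma_2_2`, `Wang2010_thm_3_6` — the two prolate inputs, with their own cites, over
  `IsProlateFunction lam N f` (bandwidth `c = 2πλ²`) — BOTH DISCHARGED at the end of this file:
  `Wang2010_lemma_2_2_holds` (Sturm comparison with the Legendre polynomial `P_n(x/λ)`, file
  `LFunctions/ProlateEigenvalueLegendreBounds.lean`) and `Wang2010_thm_3_6_holds` (the energy identities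
  (3.26) on `[−λ, λ]` + Lemma 2.2), so that `IsAppEProlateDatum.wang_inputs` is fact-free.
* PROVED here: `sonineQTerm = sonineQTermA + sonineQTermB`; `remainderTerm_eq_printed`
  (`Γ(2n+3/2) = (4n+1)‼√π/2^{2n+1}`), positivity; Lemma 49 (i) = (computersafe) for `N ≥ 2` and
  Lemma 49 (ii) = (computersafe1) as theorems from the two facts (`CC2021_lemma_49_i`, `_ii`),
  including the summability of `a(n)`.

## ERRATA located while typing (reported to the cell referee; none affects Lemma 49 as printed)

1. (Rokh) p0020:L100 `|ξ_n(1)| ≤ √(2n+½)` mis-transfers [Rokhlin–Xiao 2007, Thm 12]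
   (`ψ_m^c(1) < √(m+½)` for `‖ψ_m^c‖_{L²[−1,1]} = 1`): CC's `ξ_n = √2·ψ_{2n}^{2π}` gives
   `|ξ_n(1)| < √(4n+1)`; the paper's own values `t(3) = 0.0433983`, `λ(3) = −0.0589766` give
   `|ξ_3(1)| ≈ 3.53 > √6.5`.  The field `abs_apply_one_lt` below is the Rokhlin–Xiao inequality in
   tree normalisation (`|ψ(1)| < √(2n+½)`), which is what the §4 datum actually satisfies.
2. p0035:L29 `D_u(ξ_n) = ½(1−x²)ξ_n″ + (χ−2π²x²)ξ_n` should read `(χ/2 − 2π²x²)ξ_n` (from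
   (WLambdaq)); the printed bound `‖D_uξ_n‖ ≤ χ + ½(…)` is then a fortiori true.
3. With 1.–2. corrected, the printed (computersafe) with the printed `p(n)` still follows (Schwarz
   gives `|η_n′| ≤ 4π/√3`, and `(2+4√2)/√3 < 4+√2`; the `A`-part is `4×` loose) — checked by hand in
   the cell notes; this is why `CC2021_lemma_49_termwise` is typed with the printed `a(n)`.
4. [Rokhlin–Xiao 2007, Thm 14] (= (rapid-decay), §4 p0016:L36) is stated there for `m` sufficiently
   large only (inexplicit threshold); App. F uses it for EVERY `n ≥ 3` (Lemma F.1 (i): all `n > N`,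
   `N ≥ 2`; (ii): all `n ≥ 11`).  Here it is a hypothesis field (`abs_lam_le`), so nothing in this file
   depends on the threshold; a source valid for all `m` (or the numerical values of `λ(3..10)`) is what
   an instantiation needs — [Wang 2010] (2.6)/(3.43) concern `χ_n` and derivatives, NOT `λ(n)`, and do
   not cover it (cell GAP candidate G-cc-6).  In CC units [Rokhlin–Xiao] Thm 12 reads
   `|ξ_n(1)| < √(4n+1)` (`abs_sqrt_two_mul_apply_one_lt`).

WHAT THIS IS NOT: no statement about `ζ`, Weil positivity or RH; no definition of `ε`, `Qε`, `T_n`,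
`λ(n)` (§4–§5 files); no interval arithmetic (the number `2.366·10^{-12}` is typed as printed).
-/

noncomputable section

open Real MeasureTheory Set Filter intervalIntegral
open scoped Nat Topology

namespace Literature.NumberTheory.ConnesConsani2021

open Literature.NumberTheory.LFunctions

/-! ## The objects of Appendix F in the tree normalisation -/

/-- RH-FREE. `D_u f (x) = x f′(x)` — the scaling Hamiltonian (§5 p. 19, p0019; App. F (chunk p0035:L12
"`D_u(f)(x) = x∂_xf(x)`") for a function that is smooth on `[−1,1]` and cut off outside, the
derivative being the one within `[−1,1]` (one-sided at `±1`, as in Lemma 5.2 = arXiv Lemma 29,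
p0019:L77: "`ξ ∈ C^∞((0,1])`, … `ξ(x) := 0` for `x > 1`").  On `(−1,1)` it is `x·f′(x)`.
[cite: ConnesConsani2021, §5 Lemma 5.2 (arXiv item 29, arXiv PDF p. 29; chunk p0019:L77); App. F (chunk p0035:L12)] -/
def scaleDerivIn (f : ℝ → ℝ) (x : ℝ) : ℝ :=
  x * derivWithin f (Icc (-1) 1) x

/-- RH-FREE. `D_u f (x) = x f′(x)` for a function differentiable on `ℝ` (here: the Fourier transform `η_n`
of the cut-off prolate function, which is smooth). [cite: ConnesConsani2021, App. F, chunk p0035:L12] -/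
def scaleDeriv (f : ℝ → ℝ) (x : ℝ) : ℝ :=
  x * deriv f x

/-- RH-FREE. The Fourier transform `𝔽_{e_ℝ}ψ (y) = ∫ ψ(x) e^{-2πixy} dx` (eq. (13) p. 7) of a real EVEN
function supported in `[−1,1]`, written as the real cosine integral
`∫_{-1}^{1} ψ(x) cos(2πxy) dx` (the sine part vanishes by evenness).  For `ψ = ξ_n/√2` this is
`η_n/√2` (Prop. 4.5 (i): `η_n = 𝔽_{e_ℝ}ξ_n`); its derivative is
`−∫_{-1}^1 2πx ψ(x) sin(2πxy) dx` (App. F (chunk p0035:L55 "`η_n′(ρ) = −4π∫_0^1 sin(2πρx)ξ_n(x)x dx`").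
[cite: ConnesConsani2021, Prop. 4.5 (i) §4 (arXiv item 25, arXiv PDF p. 25; chunk p0016:L50); App. F (chunk p0035:L16)] -/
def cosTransform (ψ : ℝ → ℝ) (y : ℝ) : ℝ :=
  ∫ x in (-1 : ℝ)..1, ψ x * Real.cos (2 * π * x * y)

/-- RH-FREE. `A_n(ρ)` of App. F (p0035:L5) in tree normalisation:
`A_n(ρ) = τ(n) ρ^{1/2}∫_{ρ⁻¹}^1 (D_uξ_n)(x)(D_uζ_n)(ρx)dx = (2λ/(1−λ²)) ρ^{1/2}∫_{ρ⁻¹}^1 (D_uψ)(x)(D_uη̃)(ρx)dx`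
with `ψ = ξ_n/√2`, `η̃ = cosTransform ψ = η_n/√2`, `ζ_n = √2η̃/√(1−λ²)`, `τ(n) = λ/√(1−λ²)`.
[cite: ConnesConsani2021, App. F, chunk p0035:L5] -/
def sonineQTermA (ψ : ℝ → ℝ) (lam ρ : ℝ) : ℝ :=
  2 * lam / (1 - lam ^ 2) *
    (Real.sqrt ρ * ∫ x in ρ⁻¹..1, scaleDerivIn ψ x * scaleDeriv (cosTransform ψ) (ρ * x))

/-- RH-FREE. `B_n(ρ)` of App. F (p0035:L49) in tree normalisation:
`B_n(ρ) = τ(n)(ρ^{-1/2}(D_uξ_n)(ρ⁻¹)ζ_n(1) − ρ^{1/2}ξ_n(1)(D_uζ_n)(ρ))`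
`= (2λ/(1−λ²))(ρ^{-1/2}(D_uψ)(ρ⁻¹)η̃(1) − ρ^{1/2}ψ(1)(D_uη̃)(ρ))`.
[cite: ConnesConsani2021, App. F, chunk p0035:L49] -/
def sonineQTermB (ψ : ℝ → ℝ) (lam ρ : ℝ) : ℝ :=
  2 * lam / (1 - lam ^ 2) *
    ((Real.sqrt ρ)⁻¹ * scaleDerivIn ψ ρ⁻¹ * cosTransform ψ 1
      - Real.sqrt ρ * ψ 1 * scaleDeriv (cosTransform ψ) ρ)

/-- RH-FREE. The `n`-th term `τ(n)T_n(ρ) = λ(n)(1−λ(n)²)^{-1/2} T_n(ρ)` of the series (qe)/(sonineQ) of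
Prop. 5.3 for `Qε(ρ)` (p0020:L59–L64), in tree normalisation (module docstring):
`(2λ/(1−λ²))·(ρ^{1/2}∫_{ρ⁻¹}^1 (D_uψ)(x)(D_uη̃)(ρx)dx + ρ^{-1/2}(D_uψ)(ρ⁻¹)η̃(1) − ρ^{1/2}ψ(1)(D_uη̃)(ρ))`,
`η̃ = cosTransform ψ`.  It equals `A_n(ρ) + B_n(ρ)` (`sonineQTerm_eq_add`).  The series itself and
`Qε` are the §5 file's; App. F only bounds these terms.
[cite: ConnesConsani2021, Prop. 5.3 eq. (sonineQ) (arXiv item 30, arXiv PDF p. 32; chunk p0020:L59); App. F (chunk p0035:L88)] -/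
def sonineQTerm (ψ : ℝ → ℝ) (lam ρ : ℝ) : ℝ :=
  2 * lam / (1 - lam ^ 2) *
    (Real.sqrt ρ * (∫ x in ρ⁻¹..1, scaleDerivIn ψ x * scaleDeriv (cosTransform ψ) (ρ * x))
      + (Real.sqrt ρ)⁻¹ * scaleDerivIn ψ ρ⁻¹ * cosTransform ψ 1
      - Real.sqrt ρ * ψ 1 * scaleDeriv (cosTransform ψ) ρ)

/-- RH-FREE. `τ(n)T_n(ρ) = A_n(ρ) + B_n(ρ)` (App. F, proof of Lemma 49 (i), p0035:L87–L89).
[cite: ConnesConsani2021, App. F Lemma F.1 (arXiv Lemma 49) proof, arXiv PDF p. 55 (chunk p0035:L87)] -/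
theorem sonineQTerm_eq_add (ψ : ℝ → ℝ) (lam ρ : ℝ) :
    sonineQTerm ψ lam ρ = sonineQTermA ψ lam ρ + sonineQTermB ψ lam ρ := by
  simp only [sonineQTerm, sonineQTermA, sonineQTermB]
  ring

/-- RH-FREE. The explicit polynomial-type factor `p(n) = 16n² + 8(1+3π)n + (4+√2)√(4n+1) + 32π² + 24π + 2`
of Lemma 49 (p0035:L81). [cite: ConnesConsani2021, App. F Lemma F.1 (i) (arXiv Lemma 49), arXiv PDF p. 55 (chunk p0035:L81)] -/
def remainderPoly (n : ℕ) : ℝ :=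
  16 * (n : ℝ) ^ 2 + 8 * (1 + 3 * π) * n + (4 + Real.sqrt 2) * Real.sqrt (4 * n + 1)
    + 32 * π ^ 2 + 24 * π + 2

/-- RH-FREE. The majorant `a(n) = 2^{2n+2} π^{2n+3/2} p(n) ((2n)!)² / ((4n)! Γ(2n+3/2))` of
`|τ(n)T_n(ρ)|` in (computersafe) (Lemma 49 (i), p0035:L80), written with
`Γ(2n+3/2) = (4n+1)‼ √π / 2^{2n+1}` as the elementary closed form
`2^{4n+3} π^{2n+1} p(n) ((2n)!)² / ((4n)! (4n+1)‼)` (`remainderTerm_eq_printed`).  One has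
`a(n) = 4π · r(n) · p(n)` with `r(n)` the (rapid-decay) majorant of `|λ(n)|` (§4 p0016:L36).
[cite: ConnesConsani2021, App. F Lemma F.1 (i) (arXiv Lemma 49) eq. (computersafe), arXiv PDF p. 55 (chunk p0035:L80)] -/
def remainderTerm (n : ℕ) : ℝ :=
  2 ^ (4 * n + 3) * π ^ (2 * n + 1) * remainderPoly n * ((2 * n)! : ℝ) ^ 2
    / ((4 * n)! * ((4 * n + 1)‼ : ℕ) : ℝ)

/-- RH-FREE. `p(n) > 0`. [cite: ConnesConsani2021, App. F Lemma F.1 (i) (arXiv Lemma 49), arXiv PDF p. 55 (chunk p0035:L81)] -/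
theorem remainderPoly_pos (n : ℕ) : 0 < remainderPoly n := by
  unfold remainderPoly
  positivity

/-- RH-FREE. `a(n) > 0`. [cite: ConnesConsani2021, App. F Lemma F.1 (i) (arXiv Lemma 49), arXiv PDF p. 55 (chunk p0035:L80)] -/
theorem remainderTerm_pos (n : ℕ) : 0 < remainderTerm n := by
  unfold remainderTerm
  have := remainderPoly_pos n
  positivity

/-- RH-FREE. `a(n)` as printed: `a(n) = 2^{2n+2} π^{2n+1} √π · p(n) ((2n)!)² / ((4n)! Γ(2n+3/2))`
(`π^{2n+3/2} = π^{2n+1}√π`), by `Γ(k + ½) = (2k−1)‼ √π / 2^k` with `k = 2n+1`.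
[cite: ConnesConsani2021, App. F Lemma F.1 (i) (arXiv Lemma 49) eq. (computersafe), arXiv PDF p. 55 (chunk p0035:L80)] -/
theorem remainderTerm_eq_printed (n : ℕ) :
    remainderTerm n = 2 ^ (2 * n + 2) * π ^ (2 * n + 1) * Real.sqrt π * remainderPoly n
      * ((2 * n)! : ℝ) ^ 2 / ((4 * n)! * Real.Gamma (2 * n + 3 / 2)) := by
  have hG : Real.Gamma (2 * n + 3 / 2) = ((4 * n + 1)‼ : ℕ) * Real.sqrt π / 2 ^ (2 * n + 1) := by
    have h := Real.Gamma_nat_add_half (2 * n + 1)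
    have e1 : ((2 * n + 1 : ℕ) : ℝ) + 1 / 2 = 2 * n + 3 / 2 := by push_cast; ring
    have e2 : 2 * (2 * n + 1) - 1 = 4 * n + 1 := by omega
    rw [e1, e2] at h
    exact h
  have hπ : 0 < Real.sqrt π := Real.sqrt_pos.2 Real.pi_pos
  have hdf : (0 : ℝ) < ((4 * n + 1)‼ : ℕ) := by exact_mod_cast Nat.doubleFactorial_pos _
  have hf : (0 : ℝ) < ((4 * n)! : ℝ) := by exact_mod_cast Nat.factorial_pos _
  rw [remainderTerm, hG]
  field_simp
  ring

/-! ## The prolate datum of index `n` as Appendix F consumes it -/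

/-- RH-FREE. **The `n`-th prolate datum of §4 with the inequalities App. F imports**, in tree normalisation.
`ψ = ±ξ_n/√2` is the tree's prolate function `h_{2n,1}` (`IsProlateFunction 1 (2n) ψ`: bandwidth
`c = 2π·1² = 2π`, `2n` zeros ⟺ even index `2n`, `∫_{-1}^1ψ² = 1`, zero outside `[−1,1]`); `χ` is its
Sturm–Liouville eigenvalue (`𝐖ξ_n = χ_{2n}^{2π}ξ_n`, (WLambdaq), chunk p0015 / p0035:L27) and `lam = λ(n)`
the eigenvalue of the truncated Fourier transform ((prolateeq), chunk p0016; (chirem0.5) Prop. 4.5 (i)).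
Fields = exactly what the proof of Lemma 49 (i) uses (p0035:L7–L75): the eigen-equation;
(chirem0.5) `η_n = λ(n)ξ_n` on `[−1,1]`; `λ(n)² < 1` (Prop. 4.5 (iii): `‖ψ_n‖ = √(1−λ(n)²) ≠ 0`);
(rapid-decay) `|λ(n)| ≤ 2^{2n}π^{2n+½}((2n)!)²/((4n)!Γ(2n+3/2))` (§4 p0016:L36, [Rokhlin–Xiao 2007,
Thm 14]); `|ψ(1)| < √(2n+½)` = [Rokhlin–Xiao 2007, Thm 12] for the unit-normalised `ψ_{2n}^{2π}`
(this is (Rokh) p0020:L100 correctly transferred — see module docstring ERRATA 1);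
[Wang 2010, Lemma 2.2] `2n(2n+1) < χ < 2n(2n+1)+(2π)²` (App. F (chunk p0035:L31 "`n ≥ 3` to ensure
`χ ≥ 2π²`", p0035:L39); [Wang 2010, Thm 3.6] = (boundWang) p0035:L37 in tree normalisation
`∫_{-1}^1 (1−x²)²(ψ″)² ≤ ((2n)²+(6π+1)2n+3(2π+1)²)²`.  A `Prop`-valued structure (no data).
[cite: ConnesConsani2021, App. F (arXiv PDF pp. 54–55; chunks p0035:L7–L75); Prop. 4.5 §4 (arXiv item 25, arXiv PDF p. 25)] -/
structure IsAppEProlateDatum (n : ℕ) (ψ : ℝ → ℝ) (lam χ : ℝ) : Prop where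
  isProlate : IsProlateFunction 1 (2 * n) ψ
  eigen : ∀ x ∈ Ioo (-1 : ℝ) 1,
    -(deriv (fun y ↦ (1 ^ 2 - y ^ 2) * deriv ψ y) x) + (2 * π * 1 * x) ^ 2 * ψ x = χ * ψ x
  cosTransform_eq : ∀ x ∈ Icc (-1 : ℝ) 1, cosTransform ψ x = lam * ψ x
  sq_lam_lt : lam ^ 2 < 1
  abs_lam_le : |lam| ≤ 2 ^ (2 * n) * π ^ (2 * n) * Real.sqrt π * ((2 * n)! : ℝ) ^ 2
    / ((4 * n)! * Real.Gamma (2 * n + 3 / 2))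
  abs_apply_one_lt : |ψ 1| < Real.sqrt (2 * n + 1 / 2)
  eigen_gt : 2 * (n : ℝ) * (2 * n + 1) < χ
  eigen_lt : χ < 2 * (n : ℝ) * (2 * n + 1) + (2 * π) ^ 2
  wang : ∫ x in (-1 : ℝ)..1, ((1 - x ^ 2) * deriv (deriv ψ) x) ^ 2
    ≤ ((2 * (n : ℝ)) ^ 2 + (6 * π + 1) * (2 * n) + 3 * (2 * π + 1) ^ 2) ^ 2

/-! ## Named facts -/

/-- RH-FREE. **Lemma 49 (i), termwise form** (RH-FREE real analysis; the displayed inequality of the proof,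
p0035:L87–L92): for `n ≥ 3` and every `ρ ∈ [1,2]`,
`|λ(n)(1−λ(n)²)^{-1/2} T_n(ρ)| ≤ 2λ(n)(|A_n(ρ)|+|B_n(ρ)|) ≤ a(n) = 2^{2n+2}π^{2n+3/2}p(n)((2n)!)²/((4n)!Γ(2n+3/2))`,
"which gives (computersafe)", for the §4 prolate datum with the inequalities App. F imports
((boundAn) p0035:L45 and (boundBn) p0035:L74 are its two halves).  Typed in tree normalisation over
`IsAppEProlateDatum` (module docstring: the imported prolate inequalities are hypotheses, so this
fact records exactly the derivation of App. F; with ERRATA 1–2 of the module docstring corrected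
the printed `a(n)` still bounds the term).  Unproved here (named fact); its consequences
(computersafe)/(computersafe1) are the theorems `CC2021_lemma_49_i/_ii` below.
[cite: ConnesConsani2021, App. F Lemma F.1 (i) (arXiv Lemma 49), arXiv PDF p. 55 (chunk p0035:L78–L92)] -/
def CC2021_lemma_49_termwise : Prop :=
  ∀ (n : ℕ) (ψ : ℝ → ℝ) (lam χ : ℝ), 3 ≤ n → IsAppEProlateDatum n ψ lam χ →
    ∀ ρ ∈ Icc (1 : ℝ) 2, |sonineQTerm ψ lam ρ| ≤ remainderTerm n

/-- NUMERICAL-IN-PRINT (RH-FREE). **Lemma 49 (ii), the printed number** (NUMERICAL IN PRINT, no interval arithmetic claimed in the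
source): `Σ_{n ≥ 11} a(n) ≤ 2.366 × 10^{-12}` — in print `Σ_{11}^{34} a(n) ∼ 2.365 × 10^{-12}`
("one then simply computes the missing terms", p0035:L106–L109) and `Σ_{35}^∞ a(n) ≤ 10^{-80}`
(p0035:L94–L105: `p(n) ≤ 120n²` for `n ≥ 35`, ratio `ν_{n+1}/ν_n < n^{-2}`, `ν_{35} ≤ 5·10^{-81}`).
A decidable inequality between explicit reals (the cell re-evaluated the left side as
`2.36527…·10^{-12}`, margin `3·10^{-4}`); dischargeable by certified arithmetic, not attempted here.
[cite: ConnesConsani2021, App. F Lemma F.1 (ii) (arXiv Lemma 49), arXiv PDF p. 55 (chunk p0035:L82–L85, L94–L110)] -/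
def CC2021_lemma_49_ii_tail : Prop :=
  ∑' k : ℕ, remainderTerm (k + 11) ≤ (2.366e-12 : ℝ)

/-- RH-FREE. **[Wang 2010, Lemma 2.2]** (eq. (2.6), p. 809; proof in Wang's Appendix A): for any `c > 0` and
`n ≥ 0` the Sturm–Liouville eigenvalues of the prolate spheroidal wave functions satisfy
`n(n+1) < χ_n^c < n(n+1) + c²`.  Typed over the tree's `IsProlateFunction lam n f` (bandwidth
`c = 2πλ²`: `PW_λ = −∂(λ²−x²)∂ + (2πλx)²` is Wang's (2.1) after `x ↦ x/λ`, with the SAME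
eigenvalue; Wang's `ψ_n^c` is the `n`-th eigenfunction in increasing order of `χ`, which has exactly
`n` zeros in `(−1,1)` — Wang Lemma 2.1 (iv) — i.e. is the tree's `h_{n,λ}` up to sign).  Used by App. F
at `c = 2π`, index `2n`: `χ_{2n}^{2π} ≤ 2n(2n+1)+(2π)²` (p0035:L39) and `χ ≥ 2π²` for `n ≥ 3` (p0035:L31).
[cite: WangLL2010, Lemma 2.2 eq. (2.6) p. 809] -/
def Wang2010_lemma_2_2 : Prop :=
  ∀ (lam : ℝ) (n : ℕ) (f : ℝ → ℝ) (χ : ℝ), IsProlateFunction lam n f →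
    (∀ x ∈ Ioo (-lam) lam,
      -(deriv (fun y ↦ (lam ^ 2 - y ^ 2) * deriv f y) x) + (2 * π * lam * x) ^ 2 * f x = χ * f x) →
    (n : ℝ) * (n + 1) < χ ∧ χ < (n : ℝ) * (n + 1) + (2 * π * lam ^ 2) ^ 2

/-- RH-FREE. **[Wang 2010, Theorem 3.6, eq. (3.43)]** (p. 820), the case `φ = ψ_N^c`: with the weights
`ω = 1−x²`, `ω² = (1−x²)²` on `I = (−1,1)` and `‖ψ_N^c‖_{L²(I)} = 1`,
`‖∂_xψ_N^c‖_ω ≤ (N + 2c + 1)` and `‖∂_x²ψ_N^c‖_{ω²} ≤ N² + (3c+1)N + 3(c+1)²`.  In print the theorem is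
stated for every `φ ∈ X_N^c = span{ψ_k^c : 0 ≤ k ≤ N}` (with `‖φ‖` on the right) and first as
(3.42) `‖φ‖_{H^r_c} ≤ (χ_N^c)^{r/2}‖φ‖ ≤ (N+c+1)^r‖φ‖` for all `r ≥ 0`.
-- TODO(general form): `φ ∈ X_N^c` (finite spans of prolate functions) and the `H^r_c` scale.
Typed over `IsProlateFunction lam N f` (`c = 2πλ²`; after `x ↦ x/λ`, `f = λ^{-1/2}ψ_N^c(·/λ)`:
`‖∂ψ‖_ω² = ∫_{-λ}^{λ}(λ²−x²)(f′)²`, `‖∂²ψ‖_{ω²}² = ∫_{-λ}^{λ}(λ²−x²)²(f″)²`), squared, with `f′`, `f″`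
the derivatives on the open interval (`deriv`, a.e. on `[−λ,λ]`).  App. F uses the second inequality
at `c = 2π`, `N = 2n` as (boundWang) p0035:L37 ("note the different normalization").
[cite: WangLL2010, Thm. 3.6 eq. (3.43) p. 820] -/
def Wang2010_thm_3_6 : Prop :=
  ∀ (lam : ℝ) (N : ℕ) (f : ℝ → ℝ), IsProlateFunction lam N f →
    (∫ x in (-lam)..lam, (lam ^ 2 - x ^ 2) * (deriv f x) ^ 2)
        ≤ ((N : ℝ) + 2 * (2 * π * lam ^ 2) + 1) ^ 2 ∧
      (∫ x in (-lam)..lam, ((lam ^ 2 - x ^ 2) * deriv (deriv f) x) ^ 2)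
        ≤ ((N : ℝ) ^ 2 + (3 * (2 * π * lam ^ 2) + 1) * N + 3 * (2 * π * lam ^ 2 + 1) ^ 2) ^ 2

/-- RH-FREE. The two Wang inputs of `IsAppEProlateDatum` are instances of the two facts at `λ = 1`
(`c = 2π`), index `2n`. [cite: ConnesConsani2021, App. F, chunk p0035:L35–L39] -/
theorem IsAppEProlateDatum.wang_inputs_of (hW2 : Wang2010_lemma_2_2) (hW3 : Wang2010_thm_3_6)
    {n : ℕ} {ψ : ℝ → ℝ} {χ : ℝ} (hψ : IsProlateFunction 1 (2 * n) ψ)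
    (hχ : ∀ x ∈ Ioo (-1 : ℝ) 1,
      -(deriv (fun y ↦ (1 ^ 2 - y ^ 2) * deriv ψ y) x) + (2 * π * 1 * x) ^ 2 * ψ x = χ * ψ x) :
    (2 * (n : ℝ) * (2 * n + 1) < χ ∧ χ < 2 * (n : ℝ) * (2 * n + 1) + (2 * π) ^ 2) ∧
      ∫ x in (-1 : ℝ)..1, ((1 - x ^ 2) * deriv (deriv ψ) x) ^ 2
        ≤ ((2 * (n : ℝ)) ^ 2 + (6 * π + 1) * (2 * n) + 3 * (2 * π + 1) ^ 2) ^ 2 := by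
  have h2 := hW2 1 (2 * n) ψ χ hψ (by simpa using hχ)
  have h3 := (hW3 1 (2 * n) ψ hψ).2
  refine ⟨?_, ?_⟩
  · push_cast at h2
    constructor <;> nlinarith [h2.1, h2.2]
  · push_cast at h3
    convert h3 using 2 <;> ring


/-! ## Lemma 49: summability of the majorant and the remainder estimates (computersafe), (computersafe1) -/

/-- RH-FREE. `p(n+1) ≤ (9/4) p(n)` for `n ≥ 2` (each of the four monomials of `p` grows at most by `9/4`).
[cite: ConnesConsani2021, App. F Lemma F.1 (i) (arXiv Lemma 49), arXiv PDF p. 55 (chunk p0035:L81)] -/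
theorem remainderPoly_succ_le {n : ℕ} (hn : 2 ≤ n) :
    remainderPoly (n + 1) ≤ 9 / 4 * remainderPoly n := by
  have hn' : (2 : ℝ) ≤ n := by exact_mod_cast hn
  have hs : Real.sqrt (4 * ((n + 1 : ℕ) : ℝ) + 1) ≤ 3 / 2 * Real.sqrt (4 * n + 1) := by
    have h94 : (3 / 2 : ℝ) = Real.sqrt (9 / 4) := by
      rw [show (9 / 4 : ℝ) = (3 / 2) ^ 2 by norm_num, Real.sqrt_sq (by norm_num)]
    rw [h94, ← Real.sqrt_mul (by norm_num)]
    exact Real.sqrt_le_sqrt (by push_cast; nlinarith)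
  have h0 : 0 ≤ Real.sqrt (4 * (n : ℝ) + 1) := Real.sqrt_nonneg _
  have h2 : 0 ≤ Real.sqrt 2 := Real.sqrt_nonneg _
  unfold remainderPoly
  push_cast at hs ⊢
  nlinarith [Real.pi_pos, mul_nonneg h2 h0, mul_le_mul_of_nonneg_left hs (by positivity : (0:ℝ) ≤ 4 + Real.sqrt 2),
    Real.pi_gt_three]

/-- RH-FREE. The ratio `a(n+1)/a(n) = 4π²(2n+1)(2n+2)/((4n+1)(4n+3)²(4n+5)) · p(n+1)/p(n)` (cf. the printed
`ν_{n+1}/ν_n = 8π²(n+1)³(2n+1)/(n²(4n+1)(4n+3)²(4n+5))` for the simplified majorant `ν_n`, p0035:L100).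
[cite: ConnesConsani2021, App. F Lemma F.1 (arXiv Lemma 49) proof, arXiv PDF p. 55 (chunk p0035:L98–L102)] -/
theorem remainderTerm_succ (n : ℕ) :
    remainderTerm (n + 1) = remainderTerm n *
      (4 * π ^ 2 * ((2 * n + 1) * (2 * n + 2)) / ((4 * n + 1) * (4 * n + 3) ^ 2 * (4 * n + 5))
        * (remainderPoly (n + 1) / remainderPoly n)) := by
  have e1 : ((2 * (n + 1))! : ℝ) = (2 * n + 2) * (2 * n + 1) * (2 * n)! := by
    rw [show 2 * (n + 1) = (2 * n + 1) + 1 by ring, Nat.factorial_succ, Nat.factorial_succ]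
    push_cast; ring
  have e2 : ((4 * (n + 1))! : ℝ) = (4 * n + 4) * (4 * n + 3) * (4 * n + 2) * (4 * n + 1) * (4 * n)! := by
    rw [show 4 * (n + 1) = (4 * n + 3) + 1 by ring, Nat.factorial_succ,
      show 4 * n + 3 = (4 * n + 2) + 1 by ring, Nat.factorial_succ,
      show 4 * n + 2 = (4 * n + 1) + 1 by ring, Nat.factorial_succ, Nat.factorial_succ]
    push_cast; ring
  have e3 : (((4 * (n + 1) + 1)‼ : ℕ) : ℝ) = (4 * n + 5) * (4 * n + 3) * ((4 * n + 1)‼ : ℕ) := by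
    rw [show 4 * (n + 1) + 1 = (4 * n + 1) + 2 + 2 by ring, Nat.doubleFactorial_add_two,
      Nat.doubleFactorial_add_two]
    push_cast; ring
  have hp : remainderPoly n ≠ 0 := (remainderPoly_pos n).ne'
  have hf : ((4 * n)! : ℝ) ≠ 0 := by positivity
  have hdf : (((4 * n + 1)‼ : ℕ) : ℝ) ≠ 0 := by exact_mod_cast (Nat.doubleFactorial_pos _).ne'
  simp only [remainderTerm]
  rw [e1, e2, e3]
  field_simp
  ring

/-- RH-FREE. `a(n+1) ≤ (9/10)·a(n)` for `n ≥ 2` (crude version of the printed `n²ν_{n+1}/ν_n < 1`, p0035:L102).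
[cite: ConnesConsani2021, App. F Lemma F.1 (arXiv Lemma 49) proof, arXiv PDF p. 55 (chunk p0035:L98–L102)] -/
theorem remainderTerm_succ_le {n : ℕ} (hn : 2 ≤ n) :
    remainderTerm (n + 1) ≤ 9 / 10 * remainderTerm n := by
  have hn' : (2 : ℝ) ≤ n := by exact_mod_cast hn
  have ha : 0 < remainderTerm n := remainderTerm_pos n
  have hp : 0 < remainderPoly n := remainderPoly_pos n
  have hY : remainderPoly (n + 1) / remainderPoly n ≤ 9 / 4 := by
    rw [div_le_iff₀ hp]; exact remainderPoly_succ_le hn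
  have hY0 : 0 ≤ remainderPoly (n + 1) / remainderPoly n := by
    have := remainderPoly_pos (n + 1); positivity
  have hX : 4 * π ^ 2 * ((2 * (n : ℝ) + 1) * (2 * n + 2)) / ((4 * n + 1) * (4 * n + 3) ^ 2 * (4 * n + 5))
      ≤ 40 / 121 := by
    rw [div_le_div_iff₀ (by positivity) (by positivity)]
    have hπ : π ^ 2 < 10 := by nlinarith [Real.pi_lt_d2, Real.pi_pos]
    have h1 : (2 * (n : ℝ) + 1) * (2 * n + 2) ≤ (4 * n + 1) * (4 * n + 5) := by nlinarith
    have h2 : (121 : ℝ) ≤ (4 * n + 3) ^ 2 := by nlinarith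
    have hP0 : (0 : ℝ) ≤ (2 * (n : ℝ) + 1) * (2 * n + 2) := by positivity
    have hA : (2 * (n : ℝ) + 1) * (2 * n + 2) * 121 ≤ (4 * n + 1) * (4 * n + 5) * (4 * n + 3) ^ 2 :=
      mul_le_mul h1 h2 (by norm_num) (by positivity)
    nlinarith [mul_nonneg (sub_nonneg.2 hπ.le) hP0, hA]
  have hX0 : 0 ≤ 4 * π ^ 2 * ((2 * (n : ℝ) + 1) * (2 * n + 2))
      / ((4 * n + 1) * (4 * n + 3) ^ 2 * (4 * n + 5)) := by positivity
  rw [remainderTerm_succ]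
  calc remainderTerm n * (4 * π ^ 2 * ((2 * (n : ℝ) + 1) * (2 * n + 2))
        / ((4 * n + 1) * (4 * n + 3) ^ 2 * (4 * n + 5)) * (remainderPoly (n + 1) / remainderPoly n))
      ≤ remainderTerm n * (40 / 121 * (9 / 4)) :=
        mul_le_mul_of_nonneg_left (mul_le_mul hX hY hY0 (by norm_num)) ha.le
    _ ≤ 9 / 10 * remainderTerm n := by nlinarith [ha]

/-- RH-FREE. **The majorant series `Σ a(n)` converges** (Lemma 49 (i): "the series … is convergent",
p0035:L78; ratio test, cf. p0035:L98–L105). [cite: ConnesConsani2021, App. F Lemma F.1 (i) (arXiv Lemma 49), arXiv PDF p. 55] -/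
theorem summable_remainderTerm : Summable remainderTerm := by
  refine summable_of_ratio_norm_eventually_le (r := 9 / 10) (by norm_num) ?_
  filter_upwards [eventually_ge_atTop 2] with n hn
  rw [Real.norm_of_nonneg (remainderTerm_pos _).le, Real.norm_of_nonneg (remainderTerm_pos _).le]
  exact remainderTerm_succ_le hn

/-- RH-FREE. **Lemma 49 (i) = (computersafe)** (p0035:L78–L81), for `N ≥ 2`: if the §4 data `(ψ_n, λ(n), χ_n)`
of all indices `n > N` satisfy the relations of `IsAppEProlateDatum`, then for every `ρ ∈ [1,2]` the
tail `Σ_{n>N} τ(n)T_n(ρ)` of the series (sonineQ) converges (absolutely) and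
`|Σ_{n>N} τ(n)T_n(ρ)| ≤ Σ_{n>N} a(n)`; by Prop. 5.3 the left side is `|Qε(ρ) − Σ_0^N τ(k)T_k(ρ)|`.
Printed for every `N`; the printed proof bounds the terms for `n ≥ 3` (p0035:L31, L87), whence
`N ≥ 2` here (`N ∈ {0,1}` would need the numerical values of `λ(1), λ(2)`); (ii) uses `N = 10`.
PROVED from the termwise fact `CC2021_lemma_49_termwise` and `summable_remainderTerm`.
[cite: ConnesConsani2021, App. F Lemma F.1 (i) (arXiv Lemma 49) eq. (computersafe), arXiv PDF p. 55 (chunk p0035:L78–L81)] -/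
theorem CC2021_lemma_49_i (h : CC2021_lemma_49_termwise) {N : ℕ} (hN : 2 ≤ N)
    {ψ : ℕ → ℝ → ℝ} {lam χ : ℕ → ℝ} (hd : ∀ n, N < n → IsAppEProlateDatum n (ψ n) (lam n) (χ n))
    {ρ : ℝ} (hρ : ρ ∈ Icc (1 : ℝ) 2) :
    Summable (fun k : ℕ ↦ sonineQTerm (ψ (k + (N + 1))) (lam (k + (N + 1))) ρ) ∧
      |∑' k : ℕ, sonineQTerm (ψ (k + (N + 1))) (lam (k + (N + 1))) ρ|
        ≤ ∑' k : ℕ, remainderTerm (k + (N + 1)) := by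
  have hb : ∀ k : ℕ, ‖sonineQTerm (ψ (k + (N + 1))) (lam (k + (N + 1))) ρ‖
      ≤ remainderTerm (k + (N + 1)) := fun k ↦ by
    rw [Real.norm_eq_abs]
    exact h _ _ _ _ (by omega) (hd _ (by omega)) ρ hρ
  have hs : Summable (fun k : ℕ ↦ remainderTerm (k + (N + 1))) :=
    (summable_nat_add_iff (N + 1)).2 summable_remainderTerm
  refine ⟨Summable.of_norm_bounded hs hb, ?_⟩
  rw [← Real.norm_eq_abs]
  exact tsum_of_norm_bounded hs.hasSum hb

/-- RH-FREE. **Lemma 49 (ii) = (computersafe1)** (p0035:L82–L85): for `N = 10` the remainder is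
`≤ 2.366 × 10^{-12}` for every `ρ ∈ [1,2]`: `|Σ_{n ≥ 11} τ(n)T_n(ρ)| ≤ 2.366·10^{-12}`
(= `|Qε(ρ) − Σ_0^{10} τ(k)T_k(ρ)|` by Prop. 5.3).  PROVED from the termwise fact and the printed
number `CC2021_lemma_49_ii_tail`.
[cite: ConnesConsani2021, App. F Lemma F.1 (ii) (arXiv Lemma 49) eq. (computersafe1), arXiv PDF p. 55 (chunk p0035:L82–L85)] -/
theorem CC2021_lemma_49_ii (h : CC2021_lemma_49_termwise) (hnum : CC2021_lemma_49_ii_tail)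
    {ψ : ℕ → ℝ → ℝ} {lam χ : ℕ → ℝ} (hd : ∀ n, 10 < n → IsAppEProlateDatum n (ψ n) (lam n) (χ n))
    {ρ : ℝ} (hρ : ρ ∈ Icc (1 : ℝ) 2) :
    Summable (fun k : ℕ ↦ sonineQTerm (ψ (k + 11)) (lam (k + 11)) ρ) ∧
      |∑' k : ℕ, sonineQTerm (ψ (k + 11)) (lam (k + 11)) ρ| ≤ (2.366e-12 : ℝ) := by
  obtain ⟨hs, hb⟩ := CC2021_lemma_49_i h (N := 10) (by norm_num) hd hρ
  exact ⟨hs, hb.trans hnum⟩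

/-! ## Remark 50: the [Wang] (3.26)-type identity and the improved (boundWang) — PROVED -/

/-- RH-FREE. **Remark 50, the identity** (p0036:L1–L6; = [Wang 2010] eq. (3.26) integrated): for `f` twice
differentiable on `[−1,1]` (one-sided at the ends) with continuous `f″`, and any real `c`,
`∫_{-1}^1 (𝐖f)² = ∫_{-1}^1 (1−x²)²(f″)² + 2∫_{-1}^1 (1−x²)(1+c²x²)(f′)² + c²∫_{-1}^1 (c²x⁴+6x²−2)f²`,
`𝐖f = −(1−x²)f″ + 2xf′ + c²x²f` ((WLambdaq) in the form p0035:L25, bandwidth `c`).  Printed for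
`f ∈ C^∞([−1,1],ℝ)`; proved here by one integration of the exact derivative
`Φ′`, `Φ = −2x(1−x²)(f′)² − 2c²x²(1−x²)ff′ + 2c²x(1−x²)f²`, `Φ(±1) = 0`.
[cite: ConnesConsani2021, App. F Remark F.2 (arXiv Remark 50), arXiv PDF p. 55 (chunk p0036:L1–L6)] -/
theorem CC2021_rem_50_identity {f f' f'' : ℝ → ℝ} (c : ℝ)
    (hf : ∀ x ∈ Icc (-1 : ℝ) 1, HasDerivWithinAt f (f' x) (Icc (-1) 1) x)
    (hf' : ∀ x ∈ Icc (-1 : ℝ) 1, HasDerivWithinAt f' (f'' x) (Icc (-1) 1) x)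
    (hf''c : ContinuousOn f'' (Icc (-1) 1)) :
    ∫ x in (-1 : ℝ)..1, (-(1 - x ^ 2) * f'' x + 2 * x * f' x + c ^ 2 * x ^ 2 * f x) ^ 2 =
      (∫ x in (-1 : ℝ)..1, (1 - x ^ 2) ^ 2 * f'' x ^ 2)
        + 2 * (∫ x in (-1 : ℝ)..1, (1 - x ^ 2) * (1 + c ^ 2 * x ^ 2) * f' x ^ 2)
        + c ^ 2 * (∫ x in (-1 : ℝ)..1, (c ^ 2 * x ^ 4 + 6 * x ^ 2 - 2) * f x ^ 2) := by
  have hfc : ContinuousOn f (Icc (-1) 1) := fun x hx ↦ (hf x hx).continuousWithinAt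
  have hf'c : ContinuousOn f' (Icc (-1) 1) := fun x hx ↦ (hf' x hx).continuousWithinAt
  have hI : uIcc (-1 : ℝ) 1 = Icc (-1) 1 := uIcc_of_le (by norm_num)
  -- the boundary form and its derivative
  set Φ : ℝ → ℝ := fun y ↦ -2 * y * (1 - y ^ 2) * f' y ^ 2
      - 2 * c ^ 2 * y ^ 2 * (1 - y ^ 2) * (f y * f' y) + 2 * c ^ 2 * y * (1 - y ^ 2) * f y ^ 2 with hΦ
  set Φ' : ℝ → ℝ := fun y ↦ (-(1 - y ^ 2) * f'' y + 2 * y * f' y + c ^ 2 * y ^ 2 * f y) ^ 2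
      - ((1 - y ^ 2) ^ 2 * f'' y ^ 2 + 2 * ((1 - y ^ 2) * (1 + c ^ 2 * y ^ 2) * f' y ^ 2)
          + c ^ 2 * ((c ^ 2 * y ^ 4 + 6 * y ^ 2 - 2) * f y ^ 2)) with hΦ'
  have hderiv : ∀ x ∈ Ioo (-1 : ℝ) 1, HasDerivAt Φ (Φ' x) x := by
    intro x hx
    have hxI : Icc (-1 : ℝ) 1 ∈ 𝓝 x := Icc_mem_nhds hx.1 hx.2
    have h1 : HasDerivAt f (f' x) x := (hf x (Ioo_subset_Icc_self hx)).hasDerivAt hxI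
    have h2 : HasDerivAt f' (f'' x) x := (hf' x (Ioo_subset_Icc_self hx)).hasDerivAt hxI
    have hid : HasDerivAt (fun y : ℝ ↦ y) 1 x := hasDerivAt_id x
    have hp2 : HasDerivAt (fun y : ℝ ↦ y ^ 2) (2 * x) x := by
      simpa using hasDerivAt_pow 2 x
    have hq : HasDerivAt (fun y : ℝ ↦ 1 - y ^ 2) (-(2 * x)) x := hp2.const_sub 1
    have hA := ((hid.const_mul (-2 : ℝ)).fun_mul hq).fun_mul (h2.fun_pow 2)
    have hB := ((hp2.const_mul (2 * c ^ 2)).fun_mul hq).fun_mul (h1.fun_mul h2)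
    have hC := ((hid.const_mul (2 * c ^ 2)).fun_mul hq).fun_mul (h1.fun_pow 2)
    have h := (hA.fun_sub hB).fun_add hC
    refine h.congr_deriv ?_
    rw [hΦ']
    norm_num
    ring
  have hΦc : ContinuousOn Φ (Icc (-1) 1) := by
    rw [hΦ]
    fun_prop
  have hΦ'c : ContinuousOn Φ' (Icc (-1) 1) := by
    rw [hΦ']
    fun_prop
  have hint : IntervalIntegrable Φ' volume (-1) 1 := (hI ▸ hΦ'c).intervalIntegrable
  have hFTC : ∫ x in (-1 : ℝ)..1, Φ' x = 0 := by
    rw [integral_eq_sub_of_hasDerivAt_of_le (by norm_num) hΦc hderiv hint, hΦ]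
    norm_num
  -- integrability of the four pieces
  have i1 : IntervalIntegrable (fun x ↦ (1 - x ^ 2) ^ 2 * f'' x ^ 2) volume (-1) 1 := by
    apply ContinuousOn.intervalIntegrable; rw [hI]; fun_prop
  have i2 : IntervalIntegrable (fun x ↦ (1 - x ^ 2) * (1 + c ^ 2 * x ^ 2) * f' x ^ 2) volume (-1) 1 := by
    apply ContinuousOn.intervalIntegrable; rw [hI]; fun_prop
  have i3 : IntervalIntegrable (fun x ↦ (c ^ 2 * x ^ 4 + 6 * x ^ 2 - 2) * f x ^ 2) volume (-1) 1 := by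
    apply ContinuousOn.intervalIntegrable; rw [hI]; fun_prop
  have hsplit : ∫ x in (-1 : ℝ)..1, (-(1 - x ^ 2) * f'' x + 2 * x * f' x + c ^ 2 * x ^ 2 * f x) ^ 2
      = ∫ x in (-1 : ℝ)..1, (((1 - x ^ 2) ^ 2 * f'' x ^ 2
          + 2 * ((1 - x ^ 2) * (1 + c ^ 2 * x ^ 2) * f' x ^ 2))
          + c ^ 2 * ((c ^ 2 * x ^ 4 + 6 * x ^ 2 - 2) * f x ^ 2)) + Φ' x :=
    integral_congr fun x _ ↦ by rw [hΦ']; ring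
  rw [hsplit, integral_add ((i1.add (i2.const_mul 2)).add (i3.const_mul _)) hint, hFTC, add_zero,
    integral_add (i1.add (i2.const_mul 2)) (i3.const_mul _), integral_add i1 (i2.const_mul 2),
    intervalIntegral.integral_const_mul, intervalIntegral.integral_const_mul]

/-- RH-FREE. **Remark 50, the inequality** (p0036:L7–L10): under the same hypotheses,
`∫_{-1}^1 (1−x²)²(f″)² ≤ ∫_{-1}^1 (𝐖f)² + 2c²∫_{-1}^1 f²` (the middle term of the identity is `≥ 0`
on `[−1,1]` and `c²x⁴ + 6x² − 2 ≥ −2`). [cite: ConnesConsani2021, App. F Remark F.2 (arXiv Remark 50), arXiv PDF p. 55 (chunk p0036:L7–L10)] -/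
theorem CC2021_rem_50_ineq {f f' f'' : ℝ → ℝ} (c : ℝ)
    (hf : ∀ x ∈ Icc (-1 : ℝ) 1, HasDerivWithinAt f (f' x) (Icc (-1) 1) x)
    (hf' : ∀ x ∈ Icc (-1 : ℝ) 1, HasDerivWithinAt f' (f'' x) (Icc (-1) 1) x)
    (hf''c : ContinuousOn f'' (Icc (-1) 1)) :
    ∫ x in (-1 : ℝ)..1, (1 - x ^ 2) ^ 2 * f'' x ^ 2 ≤
      (∫ x in (-1 : ℝ)..1, (-(1 - x ^ 2) * f'' x + 2 * x * f' x + c ^ 2 * x ^ 2 * f x) ^ 2)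
        + 2 * c ^ 2 * ∫ x in (-1 : ℝ)..1, f x ^ 2 := by
  have hfc : ContinuousOn f (Icc (-1) 1) := fun x hx ↦ (hf x hx).continuousWithinAt
  have hf'c : ContinuousOn f' (Icc (-1) 1) := fun x hx ↦ (hf' x hx).continuousWithinAt
  have hI : uIcc (-1 : ℝ) 1 = Icc (-1) 1 := uIcc_of_le (by norm_num)
  rw [CC2021_rem_50_identity c hf hf' hf''c]
  have h2 : 0 ≤ ∫ x in (-1 : ℝ)..1, (1 - x ^ 2) * (1 + c ^ 2 * x ^ 2) * f' x ^ 2 := by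
    refine intervalIntegral.integral_nonneg (by norm_num) fun x hx ↦ ?_
    have : 0 ≤ 1 - x ^ 2 := by nlinarith [hx.1, hx.2]
    positivity
  have i3 : IntervalIntegrable (fun x ↦ (c ^ 2 * x ^ 4 + 6 * x ^ 2 - 2) * f x ^ 2) volume (-1) 1 := by
    apply ContinuousOn.intervalIntegrable; rw [hI]; fun_prop
  have i4 : IntervalIntegrable (fun x ↦ f x ^ 2) volume (-1) 1 := by
    apply ContinuousOn.intervalIntegrable; rw [hI]; fun_prop
  have h3 : 0 ≤ (∫ x in (-1 : ℝ)..1, (c ^ 2 * x ^ 4 + 6 * x ^ 2 - 2) * f x ^ 2)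
      + 2 * ∫ x in (-1 : ℝ)..1, f x ^ 2 := by
    rw [← intervalIntegral.integral_const_mul, ← integral_add i3 (i4.const_mul 2)]
    refine intervalIntegral.integral_nonneg (by norm_num) fun x _ ↦ ?_
    nlinarith [sq_nonneg (x ^ 2 * f x), sq_nonneg (x * f x), sq_nonneg c]
  nlinarith [sq_nonneg c, mul_nonneg (sq_nonneg c) h3]

/-- RH-FREE. The derivative package of a tree prolate function on `[−1,1]`: one-sided derivatives
`f′ = derivWithin ψ [−1,1]`, `f″ = derivWithin f′ [−1,1]` exist on the closed interval, `f″` is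
continuous there, and on the open interval they are `deriv ψ`, `deriv (deriv ψ)`.
[cite: ConnesConsaniMoscovici2025, §7 eq. (7.5)] -/
theorem hasDerivWithinAt_package {m : ℕ} {ψ : ℝ → ℝ} (hψ : IsProlateFunction 1 m ψ) :
    (∀ x ∈ Icc (-1 : ℝ) 1,
        HasDerivWithinAt ψ (derivWithin ψ (Icc (-1) 1) x) (Icc (-1) 1) x) ∧
      (∀ x ∈ Icc (-1 : ℝ) 1, HasDerivWithinAt (derivWithin ψ (Icc (-1) 1))
        (derivWithin (derivWithin ψ (Icc (-1) 1)) (Icc (-1) 1) x) (Icc (-1) 1) x) ∧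
      ContinuousOn (derivWithin (derivWithin ψ (Icc (-1) 1)) (Icc (-1) 1)) (Icc (-1) 1) ∧
      (∀ x ∈ Ioo (-1 : ℝ) 1, derivWithin ψ (Icc (-1) 1) x = deriv ψ x) ∧
      (∀ x ∈ Ioo (-1 : ℝ) 1,
        derivWithin (derivWithin ψ (Icc (-1) 1)) (Icc (-1) 1) x = deriv (deriv ψ) x) := by
  have hU : UniqueDiffOn ℝ (Icc (-1 : ℝ) 1) := uniqueDiffOn_Icc (by norm_num)
  have h2 : ContDiffOn ℝ 2 ψ (Icc (-1) 1) := by simpa using hψ.contDiffOn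
  rw [show (2 : WithTop ℕ∞) = 1 + 1 from rfl, contDiffOn_succ_iff_derivWithin hU] at h2
  obtain ⟨hd1, -, h1⟩ := h2
  rw [show (1 : WithTop ℕ∞) = 0 + 1 from rfl, contDiffOn_succ_iff_derivWithin hU] at h1
  obtain ⟨hd2, -, h0⟩ := h1
  have hIoo : ∀ x ∈ Ioo (-1 : ℝ) 1, derivWithin ψ (Icc (-1) 1) x = deriv ψ x := fun x hx ↦
    derivWithin_of_mem_nhds (Icc_mem_nhds hx.1 hx.2)
  refine ⟨fun x hx ↦ (hd1 x hx).hasDerivWithinAt, fun x hx ↦ (hd2 x hx).hasDerivWithinAt,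
    h0.continuousOn, hIoo, fun x hx ↦ ?_⟩
  rw [derivWithin_of_mem_nhds (Icc_mem_nhds hx.1 hx.2)]
  refine Filter.EventuallyEq.deriv_eq ?_
  filter_upwards [isOpen_Ioo.mem_nhds hx] with y hy using hIoo y hy

/-- RH-FREE. **Remark 50, the improved (boundWang)** (p0036:L11–L14) in tree normalisation: for the prolate
function `ψ = ξ_n/√2` with eigenvalue `χ = χ_{2n}^{2π} ≥ 0`,
`∫_{-1}^1 (1−x²)²(ψ″)² ≤ χ² + 2c²` (`c = 2π`; CC: `(∫_0^1 (ξ_n″)²(1−x²)²)^{1/2} ≤ √(χ²+2c²)`, using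
`𝐖ξ_n = χξ_n` and `∫_0^1ξ_n² = 1`), and with [Wang] (2.6) `χ ≤ 2n(2n+1)+(2π)²`:
`(∫_{-1}^1 (1−x²)²(ψ″)²)^{1/2} ≤ 2n(2n+1) + (2π)²(1+√2)`.  PROVED (RH-free calculus).
[cite: ConnesConsani2021, App. F Remark F.2 (arXiv Remark 50), arXiv PDF p. 55 (chunk p0036:L11–L14)] -/
theorem CC2021_rem_50_bound {n : ℕ} {ψ : ℝ → ℝ} {χ : ℝ} (hψ : IsProlateFunction 1 (2 * n) ψ)
    (hχ : ∀ x ∈ Ioo (-1 : ℝ) 1,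
      -(deriv (fun y ↦ (1 ^ 2 - y ^ 2) * deriv ψ y) x) + (2 * π * 1 * x) ^ 2 * ψ x = χ * ψ x)
    (hχ0 : 0 ≤ χ) (hχle : χ ≤ 2 * (n : ℝ) * (2 * n + 1) + (2 * π) ^ 2) :
    (∫ x in (-1 : ℝ)..1, ((1 - x ^ 2) * deriv (deriv ψ) x) ^ 2) ≤ χ ^ 2 + 2 * (2 * π) ^ 2 ∧
      Real.sqrt (∫ x in (-1 : ℝ)..1, ((1 - x ^ 2) * deriv (deriv ψ) x) ^ 2)
        ≤ 2 * (n : ℝ) * (2 * n + 1) + (2 * π) ^ 2 * (1 + Real.sqrt 2) := by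
  obtain ⟨hf, hf', hf''c, e1, e2⟩ := hasDerivWithinAt_package hψ
  set f' := derivWithin ψ (Icc (-1) 1) with hf'def
  set f'' := derivWithin f' (Icc (-1) 1) with hf''def
  have hode := hψ.ode_of_eigen hχ
  -- a.e. on `Ι (-1) 1` the point `1` is avoided
  have hae : ∀ᵐ x : ℝ, x ≠ 1 := by
    rw [ae_iff]; simp
  have hmem : ∀ x : ℝ, x ∈ Set.uIoc (-1 : ℝ) 1 → x ≠ 1 → x ∈ Ioo (-1 : ℝ) 1 := fun x hx h1 ↦ by
    rw [uIoc_of_le (by norm_num)] at hx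
    exact ⟨hx.1, lt_of_le_of_ne hx.2 h1⟩
  -- `𝐖ψ = χψ` on the open interval, in terms of `f′, f″`
  have hW : ∀ x ∈ Ioo (-1 : ℝ) 1,
      -(1 - x ^ 2) * f'' x + 2 * x * f' x + (2 * π) ^ 2 * x ^ 2 * ψ x = χ * ψ x := by
    intro x hx
    rw [e1 x hx, e2 x hx]
    have := hode x hx
    linear_combination (-1 : ℝ) * this
  have hint1 : ∫ x in (-1 : ℝ)..1, (-(1 - x ^ 2) * f'' x + 2 * x * f' x + (2 * π) ^ 2 * x ^ 2 * ψ x) ^ 2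
      = χ ^ 2 := by
    have : ∫ x in (-1 : ℝ)..1, (-(1 - x ^ 2) * f'' x + 2 * x * f' x + (2 * π) ^ 2 * x ^ 2 * ψ x) ^ 2
        = ∫ x in (-1 : ℝ)..1, χ ^ 2 * ψ x ^ 2 := by
      refine integral_congr_ae ?_
      filter_upwards [hae] with x hx1 hx
      rw [hW x (hmem x hx hx1)]; ring
    have hnorm' : ∫ x in (-1 : ℝ)..1, ψ x ^ 2 = 1 := by simpa using hψ.norm_one
    rw [this, intervalIntegral.integral_const_mul, hnorm', mul_one]
  have hint2 : ∫ x in (-1 : ℝ)..1, ((1 - x ^ 2) * deriv (deriv ψ) x) ^ 2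
      = ∫ x in (-1 : ℝ)..1, (1 - x ^ 2) ^ 2 * f'' x ^ 2 := by
    refine integral_congr_ae ?_
    filter_upwards [hae] with x hx1 hx
    rw [← e2 x (hmem x hx hx1)]; ring
  have hmain := CC2021_rem_50_ineq (2 * π) hf hf' hf''c
  have hnorm : ∫ x in (-1 : ℝ)..1, ψ x ^ 2 = 1 := by simpa using hψ.norm_one
  rw [hint1, hnorm] at hmain
  have hA : (∫ x in (-1 : ℝ)..1, ((1 - x ^ 2) * deriv (deriv ψ) x) ^ 2) ≤ χ ^ 2 + 2 * (2 * π) ^ 2 := by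
    rw [hint2]; linarith
  refine ⟨hA, ?_⟩
  -- `√(χ² + 2c²) ≤ χ + √2·c ≤ 2n(2n+1) + c² + √2 c²` (`c = 2π ≥ 1`)
  have hc1 : (1 : ℝ) ≤ 2 * π := by linarith [Real.pi_gt_three]
  have hs2 : 0 ≤ Real.sqrt 2 := Real.sqrt_nonneg 2
  have hs2sq : Real.sqrt 2 ^ 2 = 2 := Real.sq_sqrt (by norm_num)
  calc Real.sqrt (∫ x in (-1 : ℝ)..1, ((1 - x ^ 2) * deriv (deriv ψ) x) ^ 2)
      ≤ Real.sqrt ((χ + Real.sqrt 2 * (2 * π)) ^ 2) := by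
        refine Real.sqrt_le_sqrt (hA.trans ?_)
        nlinarith [mul_nonneg hχ0 (mul_nonneg hs2 (by positivity : (0 : ℝ) ≤ 2 * π))]
    _ = χ + Real.sqrt 2 * (2 * π) := Real.sqrt_sq (by positivity)
    _ ≤ 2 * (n : ℝ) * (2 * n + 1) + (2 * π) ^ 2 * (1 + Real.sqrt 2) := by
        nlinarith [mul_le_mul_of_nonneg_left hc1 (mul_nonneg hs2 (by positivity : (0:ℝ) ≤ 2 * π))]

/-! ## Discharge of `CC2021_lemma_49_termwise` (App. F, arXiv PDF pp. 54–55, made quantitative)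

The printed chain, in tree normalisation and with the two slips of the module docstring (ERRATA 1–2)
repaired: `|η̃′| ≤ 2π∫|ψ| ≤ 2π·99/70` (Schwarz, here by `|ψ| ≤ 7/20 + (5/7)ψ²`), the eigen-equation
`xψ′ = ½(1−x²)ψ″ + ½(χ − 4π²x²)ψ`, [Wang] (3.43) and (2.6), [Rokhlin–Xiao] Thm 12, (rapid-decay). -/

/-- RH-FREE. The common ratio factor of `a(n+1)/a(n)` and `r(n+1)/r(n)` is `≤ 40/121` for `n ≥ 2`.
[cite: ConnesConsani2021, App. F Lemma F.1 (arXiv Lemma 49) proof, arXiv PDF p. 55 (chunk p0035:L98–L102)] -/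
theorem ratio_le {n : ℕ} (hn : 2 ≤ n) :
    4 * π ^ 2 * ((2 * (n : ℝ) + 1) * (2 * n + 2)) / ((4 * n + 1) * (4 * n + 3) ^ 2 * (4 * n + 5))
      ≤ 40 / 121 := by
  have hn' : (2 : ℝ) ≤ n := by exact_mod_cast hn
  rw [div_le_div_iff₀ (by positivity) (by positivity)]
  have hπ : π ^ 2 < 10 := by nlinarith [Real.pi_lt_d2, Real.pi_pos]
  have h1 : (2 * (n : ℝ) + 1) * (2 * n + 2) ≤ (4 * n + 1) * (4 * n + 5) := by nlinarith
  have h2 : (121 : ℝ) ≤ (4 * n + 3) ^ 2 := by nlinarith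
  have hP0 : (0 : ℝ) ≤ (2 * (n : ℝ) + 1) * (2 * n + 2) := by positivity
  have hA : (2 * (n : ℝ) + 1) * (2 * n + 2) * 121 ≤ (4 * n + 1) * (4 * n + 5) * (4 * n + 3) ^ 2 :=
    mul_le_mul h1 h2 (by norm_num) (by positivity)
  nlinarith [mul_nonneg (sub_nonneg.2 hπ.le) hP0, hA]

/-- RH-FREE. The derivative of the truncated cosine transform: for `ψ` continuous on `[−1,1]`,
`η̃′(y) = −∫_{-1}^1 2πx ψ(x) sin(2πxy) dx` (App. F (chunk p0035:L55: "`η_n′(ρ) = −4π∫_0^1 sin(2πρx)ξ_n(x)x dx`").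
[cite: ConnesConsani2021, App. F, chunk p0035:L55] -/
theorem hasDerivAt_cosTransform {ψ : ℝ → ℝ} (hψ : ContinuousOn ψ (Icc (-1) 1)) (y : ℝ) :
    HasDerivAt (cosTransform ψ)
      (∫ x in (-1 : ℝ)..1, ψ x * (-(2 * π * x) * Real.sin (2 * π * x * y))) y := by
  have hI : uIcc (-1 : ℝ) 1 = Icc (-1) 1 := uIcc_of_le (by norm_num)
  have hIoc : Set.uIoc (-1 : ℝ) 1 = Ioc (-1) 1 := uIoc_of_le (by norm_num)
  have hmeas : ∀ z : ℝ, AEStronglyMeasurable (fun x ↦ ψ x * Real.cos (2 * π * x * z))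
      (volume.restrict (Set.uIoc (-1 : ℝ) 1)) := fun z ↦ by
    rw [hIoc]
    refine (ContinuousOn.aestronglyMeasurable ?_ measurableSet_Icc).mono_measure
      (Measure.restrict_mono Ioc_subset_Icc_self le_rfl)
    exact hψ.mul (by fun_prop)
  have hmeas' : AEStronglyMeasurable (fun x ↦ ψ x * (-(2 * π * x) * Real.sin (2 * π * x * y)))
      (volume.restrict (Set.uIoc (-1 : ℝ) 1)) := by
    rw [hIoc]
    refine (ContinuousOn.aestronglyMeasurable ?_ measurableSet_Icc).mono_measure
      (Measure.restrict_mono Ioc_subset_Icc_self le_rfl)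
    exact hψ.mul (by fun_prop)
  have hint : IntervalIntegrable (fun x ↦ ψ x * Real.cos (2 * π * x * y)) volume (-1) 1 := by
    apply ContinuousOn.intervalIntegrable; rw [hI]; exact hψ.mul (by fun_prop)
  have hbound : IntervalIntegrable (fun x ↦ 2 * π * |ψ x|) volume (-1) 1 := by
    apply ContinuousOn.intervalIntegrable; rw [hI]; exact (hψ.abs).const_mul _ |>.congr fun _ _ ↦ rfl
  have h := intervalIntegral.hasDerivAt_integral_of_dominated_loc_of_deriv_le
    (F := fun z x ↦ ψ x * Real.cos (2 * π * x * z))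
    (F' := fun z x ↦ ψ x * (-(2 * π * x) * Real.sin (2 * π * x * z)))
    (x₀ := y) (s := univ) (bound := fun x ↦ 2 * π * |ψ x|) (μ := volume) (a := -1) (b := 1)
    univ_mem (Eventually.of_forall hmeas) hint hmeas' ?_ hbound ?_
  · exact h.2
  · refine Eventually.of_forall fun x hx z _ ↦ ?_
    rw [hIoc] at hx
    have hx1 : |x| ≤ 1 := abs_le.2 ⟨hx.1.le, hx.2⟩
    rw [Real.norm_eq_abs, abs_mul, abs_mul, abs_neg]
    calc |ψ x| * (|2 * π * x| * |Real.sin (2 * π * x * z)|)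
        ≤ |ψ x| * (2 * π * 1 * 1) := by
          gcongr
          · rw [abs_mul, abs_of_pos (by positivity : (0 : ℝ) < 2 * π)]
            gcongr
          · exact Real.abs_sin_le_one _
      _ = 2 * π * |ψ x| := by ring
  · refine Eventually.of_forall fun x _ z _ ↦ ?_
    have := (((hasDerivAt_id' z).const_mul (2 * π * x)).cos).const_mul (ψ x)
    exact this.congr_deriv (by ring)

/-- RH-FREE. `∫_{-1}^1 |ψ| ≤ 99/70` for the unit-normalised prolate function (Schwarz: `≤ √2`;
here from `|ψ| ≤ 7/20 + (5/7)ψ²`). [cite: ConnesConsani2021, App. F, chunk p0035:L55 (Schwarz's inequality)] -/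
theorem integral_abs_le_of_sq_one {ψ : ℝ → ℝ} (hψ : ContinuousOn ψ (Icc (-1) 1))
    (h1 : ∫ x in (-1 : ℝ)..1, ψ x ^ 2 = 1) : ∫ x in (-1 : ℝ)..1, |ψ x| ≤ 99 / 70 := by
  have hI : uIcc (-1 : ℝ) 1 = Icc (-1) 1 := uIcc_of_le (by norm_num)
  have i1 : IntervalIntegrable (fun x ↦ |ψ x|) volume (-1) 1 := by
    apply ContinuousOn.intervalIntegrable; rw [hI]; exact hψ.abs
  have i2 : IntervalIntegrable (fun x ↦ (7 / 20 : ℝ) + 5 / 7 * ψ x ^ 2) volume (-1) 1 := by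
    apply ContinuousOn.intervalIntegrable; rw [hI]; fun_prop
  calc ∫ x in (-1 : ℝ)..1, |ψ x| ≤ ∫ x in (-1 : ℝ)..1, ((7 / 20 : ℝ) + 5 / 7 * ψ x ^ 2) := by
        refine intervalIntegral.integral_mono_on (by norm_num) i1 i2 fun x _ ↦ ?_
        nlinarith [sq_nonneg (|ψ x| - 7 / 10), sq_abs (ψ x)]
    _ = 99 / 70 := by
        rw [intervalIntegral.integral_add (by simp) (by
          apply ContinuousOn.intervalIntegrable; rw [hI]; fun_prop),
          intervalIntegral.integral_const_mul, h1]
        simp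
        norm_num

/-- RH-FREE. The uniform bound `|η̃′(y)| ≤ 2π·99/70` (`= 99π/35`; CC: "`|η_n′| ≤ 4π`" in their
normalisation, p0035:L53–L55) for `ψ` continuous on `[−1,1]` with `∫_{-1}^1ψ² = 1`.
[cite: ConnesConsani2021, App. F, chunk p0035:L53–L55] -/
theorem abs_deriv_cosTransform_le {ψ : ℝ → ℝ} (hψ : ContinuousOn ψ (Icc (-1) 1))
    (h1 : ∫ x in (-1 : ℝ)..1, ψ x ^ 2 = 1) (y : ℝ) :
    |deriv (cosTransform ψ) y| ≤ 99 * π / 35 := by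
  have hI : uIcc (-1 : ℝ) 1 = Icc (-1) 1 := uIcc_of_le (by norm_num)
  rw [(hasDerivAt_cosTransform hψ y).deriv]
  have hb : IntervalIntegrable (fun x ↦ 2 * π * |ψ x|) volume (-1) 1 := by
    apply ContinuousOn.intervalIntegrable; rw [hI]
    exact (continuousOn_const.mul hψ.abs)
  calc |∫ x in (-1 : ℝ)..1, ψ x * (-(2 * π * x) * Real.sin (2 * π * x * y))|
      ≤ ∫ x in (-1 : ℝ)..1, 2 * π * |ψ x| := by
        rw [← Real.norm_eq_abs]
        refine intervalIntegral.norm_integral_le_of_norm_le (by norm_num) ?_ hb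
        refine Eventually.of_forall fun x hx ↦ ?_
        have hx1 : |x| ≤ 1 := abs_le.2 ⟨hx.1.le, hx.2⟩
        rw [Real.norm_eq_abs, abs_mul, abs_mul, abs_neg]
        calc |ψ x| * (|2 * π * x| * |Real.sin (2 * π * x * y)|)
            ≤ |ψ x| * (2 * π * 1 * 1) := by
              gcongr
              · rw [abs_mul, abs_of_pos (by positivity : (0 : ℝ) < 2 * π)]
                gcongr
              · exact Real.abs_sin_le_one _
          _ = 2 * π * |ψ x| := by ring
    _ = 2 * π * ∫ x in (-1 : ℝ)..1, |ψ x| := intervalIntegral.integral_const_mul _ _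
    _ ≤ 2 * π * (99 / 70) := by
        gcongr
        exact integral_abs_le_of_sq_one hψ h1
    _ = 99 * π / 35 := by ring

/-- RH-FREE. The prolate equation on the CLOSED interval in terms of the one-sided derivatives
`f′ = derivWithin ψ [−1,1]`, `f″ = derivWithin f′ [−1,1]`:
`(1−x²)f″ = 2xf′ + ((2πx)²−χ)ψ` on `[−1,1]` (extended from `(−1,1)` by continuity).
[cite: ConnesConsani2021, §4 eq. (WLambdaq) (chunk p0015); App. F (chunk p0035:L25–L29)] -/
theorem ode_Icc_of_eigen {m : ℕ} {ψ : ℝ → ℝ} {χ : ℝ} (hψ : IsProlateFunction 1 m ψ)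
    (hχ : ∀ x ∈ Ioo (-1 : ℝ) 1,
      -(deriv (fun y ↦ (1 ^ 2 - y ^ 2) * deriv ψ y) x) + (2 * π * 1 * x) ^ 2 * ψ x = χ * ψ x) :
    ∀ x ∈ Icc (-1 : ℝ) 1,
      (1 - x ^ 2) * derivWithin (derivWithin ψ (Icc (-1) 1)) (Icc (-1) 1) x
        = 2 * x * derivWithin ψ (Icc (-1) 1) x + ((2 * π * x) ^ 2 - χ) * ψ x := by
  obtain ⟨hf, hf', hf''c, e1, e2⟩ := hasDerivWithinAt_package hψ
  have hfc : ContinuousOn ψ (Icc (-1) 1) := fun x hx ↦ (hf x hx).continuousWithinAt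
  have hf'c : ContinuousOn (derivWithin ψ (Icc (-1) 1)) (Icc (-1) 1) :=
    fun x hx ↦ (hf' x hx).continuousWithinAt
  have hode := hψ.ode_of_eigen hχ
  have hIoo : EqOn (fun x ↦ (1 - x ^ 2) * derivWithin (derivWithin ψ (Icc (-1) 1)) (Icc (-1) 1) x)
      (fun x ↦ 2 * x * derivWithin ψ (Icc (-1) 1) x + ((2 * π * x) ^ 2 - χ) * ψ x)
      (Ioo (-1 : ℝ) 1) := by
    intro x hx
    simp only
    rw [e2 x hx, e1 x hx]
    have := hode x hx
    simp only [one_pow, mul_one] at this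
    exact this
  refine hIoo.of_subset_closure ?_ ?_ Ioo_subset_Icc_self ?_
  · exact ContinuousOn.mul (by fun_prop) hf''c
  · exact ((ContinuousOn.mul (by fun_prop) hf'c).add (ContinuousOn.mul (by fun_prop) hfc))
  · rw [closure_Ioo (by norm_num)]

/-- RH-FREE. The "proportionality" step of App. F (p0035:L60–L62): by (chirem0.5) `η̃ = λψ` on
`[−1,1]`, hence `λ·ψ′ = η̃′` there (one-sided at the ends), `η̃` being differentiable on `ℝ`.
[cite: ConnesConsani2021, App. F, chunk p0035:L60–L62] -/
theorem IsAppEProlateDatum.lam_mul_derivWithin {n : ℕ} {ψ : ℝ → ℝ} {lam χ : ℝ}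
    (d : IsAppEProlateDatum n ψ lam χ) {y : ℝ} (hy : y ∈ Icc (-1 : ℝ) 1) :
    lam * derivWithin ψ (Icc (-1) 1) y = deriv (cosTransform ψ) y := by
  have hU : UniqueDiffWithinAt ℝ (Icc (-1 : ℝ) 1) y := uniqueDiffOn_Icc (by norm_num) y hy
  have hψc : ContinuousOn ψ (Icc (-1) 1) := by simpa using d.isProlate.contDiffOn.continuousOn
  obtain ⟨hf, -, -, -, -⟩ := hasDerivWithinAt_package d.isProlate
  have hη := hasDerivAt_cosTransform hψc y
  rw [hη.deriv, ← hη.hasDerivWithinAt.derivWithin hU,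
    derivWithin_congr (fun x hx ↦ d.cosTransform_eq x hx) (d.cosTransform_eq y hy),
    derivWithin_const_mul lam (hf y hy).differentiableWithinAt]

/-- RH-FREE. The `ξ`-side `L¹` estimate of App. F (p0035:L24–L41), here over `[a,1] ⊇ [ρ⁻¹,1]`,
`½ ≤ a ≤ 1`, for abstract `ψ, f′, f″` on `[−1,1]` satisfying the prolate equation
`(1−x²)f″ = 2xf′ + ((2πx)²−χ)ψ` with `χ ≥ 4π²`, [Wang] (3.43) `∫_{-1}^1((1−x²)f″)² ≤ W₀²` and
`∫_{-1}^1ψ² = 1`: by `|u| ≤ t/2 + u²/(2t)` (in place of Schwarz),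
`∫_a^1 |x f′(x)| ≤ (99/280)(W₀ + χ)`. [cite: ConnesConsani2021, App. F, chunk p0035:L24–L41] -/
theorem integral_abs_mul_deriv_le {ψ f' f'' : ℝ → ℝ} {χ W₀ a : ℝ}
    (hψc : ContinuousOn ψ (Icc (-1) 1)) (hf'c : ContinuousOn f' (Icc (-1) 1))
    (hf''c : ContinuousOn f'' (Icc (-1) 1))
    (hode : ∀ x ∈ Icc (-1 : ℝ) 1, (1 - x ^ 2) * f'' x = 2 * x * f' x + ((2 * π * x) ^ 2 - χ) * ψ x)
    (hχ : 4 * π ^ 2 ≤ χ) (hW₀ : 0 < W₀)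
    (hwang : ∫ x in (-1 : ℝ)..1, ((1 - x ^ 2) * f'' x) ^ 2 ≤ W₀ ^ 2)
    (hnorm : ∫ x in (-1 : ℝ)..1, ψ x ^ 2 = 1) (ha : 1 / 2 ≤ a) (ha1 : a ≤ 1) :
    ∫ x in a..1, |x * f' x| ≤ 99 / 280 * (W₀ + χ) := by
  have hχ0 : 0 ≤ χ := le_trans (by positivity) hχ
  have hsub : Icc a 1 ⊆ Icc (-1 : ℝ) 1 := Icc_subset_Icc (by linarith) le_rfl
  have hIa : uIcc a 1 = Icc a 1 := uIcc_of_le ha1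
  -- pointwise bound on `[a, 1]`
  have hpt : ∀ x ∈ Icc a 1, |x * f' x| ≤
      (7 * W₀ / 20 + 5 / (28 * W₀) * ((1 - x ^ 2) * f'' x) ^ 2)
        + (7 * χ / 20 + 5 * χ / 28 * ψ x ^ 2) := by
    intro x hx
    have hxI : x ∈ Icc (-1 : ℝ) 1 := hsub hx
    have hx1 : x ^ 2 ≤ 1 := by nlinarith [hxI.1, hxI.2]
    have hD : x * f' x = 1 / 2 * ((1 - x ^ 2) * f'' x) + 1 / 2 * ((χ - (2 * π * x) ^ 2) * ψ x) := by
      linear_combination (-1 / 2 : ℝ) * hode x hxI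
    rw [hD]
    have hcoef : |χ - (2 * π * x) ^ 2| ≤ χ := by
      rw [abs_le]; constructor <;> nlinarith [Real.pi_pos]
    set u := (1 - x ^ 2) * f'' x with hu_def
    have hkey : |u| * (14 * W₀) ≤ 7 * W₀ / 10 * (14 * W₀) + 5 * u ^ 2 := by
      nlinarith [sq_nonneg (|u| - 7 * W₀ / 5), sq_abs u]
    have hu : |u| ≤ 7 * W₀ / 10 + 5 / (14 * W₀) * u ^ 2 := by
      have h14 : (0 : ℝ) < 14 * W₀ := by positivity
      have : 7 * W₀ / 10 + 5 / (14 * W₀) * u ^ 2 = (7 * W₀ / 10 * (14 * W₀) + 5 * u ^ 2) / (14 * W₀) := by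
        field_simp
      rw [this, le_div_iff₀ h14]
      exact hkey
    have hv : |ψ x| ≤ 7 / 10 + 5 / 14 * ψ x ^ 2 := by
      nlinarith [sq_nonneg (|ψ x| - 7 / 5), sq_abs (ψ x)]
    have h2 : |χ - (2 * π * x) ^ 2| * |ψ x| ≤ χ * (7 / 10 + 5 / 14 * ψ x ^ 2) :=
      mul_le_mul hcoef hv (abs_nonneg _) hχ0
    calc |1 / 2 * u + 1 / 2 * ((χ - (2 * π * x) ^ 2) * ψ x)|
        ≤ |1 / 2 * u| + |1 / 2 * ((χ - (2 * π * x) ^ 2) * ψ x)| := abs_add_le _ _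
      _ = 1 / 2 * |u| + 1 / 2 * (|χ - (2 * π * x) ^ 2| * |ψ x|) := by
          rw [abs_mul (1 / 2 : ℝ) u, abs_mul (1 / 2 : ℝ) (_ * ψ x), abs_mul (χ - _) (ψ x),
            abs_of_pos (by norm_num : (0:ℝ) < 1 / 2)]
      _ ≤ 1 / 2 * (7 * W₀ / 10 + 5 / (14 * W₀) * u ^ 2)
            + 1 / 2 * (χ * (7 / 10 + 5 / 14 * ψ x ^ 2)) :=
          add_le_add (mul_le_mul_of_nonneg_left hu (by norm_num))
            (mul_le_mul_of_nonneg_left h2 (by norm_num))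
      _ = _ := by ring
  -- integrability on `[a, 1]`
  have iL : IntervalIntegrable (fun x ↦ |x * f' x|) volume a 1 := by
    refine (ContinuousOn.intervalIntegrable ?_).abs
    rw [hIa]; exact ContinuousOn.mul (by fun_prop) (hf'c.mono hsub)
  have i1 : IntervalIntegrable (fun x ↦ ((1 - x ^ 2) * f'' x) ^ 2) volume a 1 := by
    apply ContinuousOn.intervalIntegrable; rw [hIa]
    exact (ContinuousOn.mul (by fun_prop) (hf''c.mono hsub)).pow 2
  have i2 : IntervalIntegrable (fun x ↦ ψ x ^ 2) volume a 1 := by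
    apply ContinuousOn.intervalIntegrable; rw [hIa]
    exact (hψc.mono hsub).pow 2
  have iR1 : IntervalIntegrable (fun x ↦ 7 * W₀ / 20 + 5 / (28 * W₀) * ((1 - x ^ 2) * f'' x) ^ 2)
      volume a 1 := intervalIntegrable_const.add (i1.const_mul _)
  have iR2 : IntervalIntegrable (fun x ↦ 7 * χ / 20 + 5 * χ / 28 * ψ x ^ 2) volume a 1 :=
    intervalIntegrable_const.add (i2.const_mul _)
  -- the two global integrals
  have hI1 : ∫ x in a..1, ((1 - x ^ 2) * f'' x) ^ 2 ≤ W₀ ^ 2 := by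
    have i1' : IntervalIntegrable (fun x ↦ ((1 - x ^ 2) * f'' x) ^ 2) volume (-1) 1 := by
      apply ContinuousOn.intervalIntegrable; rw [uIcc_of_le (by norm_num)]
      exact (ContinuousOn.mul (by fun_prop) hf''c).pow 2
    calc ∫ x in a..1, ((1 - x ^ 2) * f'' x) ^ 2 ≤ ∫ x in (-1 : ℝ)..1, ((1 - x ^ 2) * f'' x) ^ 2 :=
          intervalIntegral.integral_mono_interval (by linarith) ha1 le_rfl
            (Eventually.of_forall fun x ↦ sq_nonneg _) i1'
      _ ≤ W₀ ^ 2 := hwang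
  have hI2 : ∫ x in a..1, ψ x ^ 2 ≤ 1 := by
    have i2' : IntervalIntegrable (fun x ↦ ψ x ^ 2) volume (-1) 1 := by
      apply ContinuousOn.intervalIntegrable; rw [uIcc_of_le (by norm_num)]; exact hψc.pow 2
    calc ∫ x in a..1, ψ x ^ 2 ≤ ∫ x in (-1 : ℝ)..1, ψ x ^ 2 :=
          intervalIntegral.integral_mono_interval (by linarith) ha1 le_rfl
            (Eventually.of_forall fun x ↦ sq_nonneg _) i2'
      _ = 1 := hnorm
  have hsplit : ∫ x in a..1, ((7 * W₀ / 20 + 5 / (28 * W₀) * ((1 - x ^ 2) * f'' x) ^ 2)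
        + (7 * χ / 20 + 5 * χ / 28 * ψ x ^ 2))
      = ((1 - a) * (7 * W₀ / 20) + 5 / (28 * W₀) * ∫ x in a..1, ((1 - x ^ 2) * f'' x) ^ 2)
        + ((1 - a) * (7 * χ / 20) + 5 * χ / 28 * ∫ x in a..1, ψ x ^ 2) := by
    rw [intervalIntegral.integral_add iR1 iR2,
      intervalIntegral.integral_add intervalIntegrable_const (i1.const_mul _),
      intervalIntegral.integral_add intervalIntegrable_const (i2.const_mul _),
      intervalIntegral.integral_const, intervalIntegral.integral_const,
      intervalIntegral.integral_const_mul, intervalIntegral.integral_const_mul, smul_eq_mul, smul_eq_mul]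
  calc ∫ x in a..1, |x * f' x|
      ≤ ∫ x in a..1, ((7 * W₀ / 20 + 5 / (28 * W₀) * ((1 - x ^ 2) * f'' x) ^ 2)
          + (7 * χ / 20 + 5 * χ / 28 * ψ x ^ 2)) :=
        intervalIntegral.integral_mono_on ha1 iL (iR1.add iR2) hpt
    _ = ((1 - a) * (7 * W₀ / 20) + 5 / (28 * W₀) * ∫ x in a..1, ((1 - x ^ 2) * f'' x) ^ 2)
        + ((1 - a) * (7 * χ / 20) + 5 * χ / 28 * ∫ x in a..1, ψ x ^ 2) := hsplit
    _ ≤ (1 / 2 * (7 * W₀ / 20) + 5 / (28 * W₀) * W₀ ^ 2) + (1 / 2 * (7 * χ / 20) + 5 * χ / 28 * 1) := by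
        have h1a : 1 - a ≤ 1 / 2 := by linarith
        gcongr
    _ = 99 / 280 * (W₀ + χ) := by
        field_simp
        ring

/-- RH-FREE. The (rapid-decay) majorant `r(n) = 2^{2n}π^{2n+½}((2n)!)²/((4n)!Γ(2n+3/2))` equals
`a(n)/(4π p(n))`. [cite: ConnesConsani2021, §4 eq. (rapid-decay) (chunk p0016:L36); App. F (chunk p0035:L80)] -/
theorem rapidDecay_eq (n : ℕ) :
    2 ^ (2 * n) * π ^ (2 * n) * Real.sqrt π * ((2 * n)! : ℝ) ^ 2
        / ((4 * n)! * Real.Gamma (2 * n + 3 / 2))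
      = remainderTerm n / (4 * π * remainderPoly n) := by
  rw [remainderTerm_eq_printed]
  have hp := remainderPoly_pos n
  have hΓ : 0 < Real.Gamma (2 * n + 3 / 2) := Real.Gamma_pos_of_pos (by positivity)
  have hf : (0 : ℝ) < ((4 * n)! : ℝ) := by positivity
  have hπ := Real.pi_pos
  field_simp
  ring

/-- RH-FREE. `r(n+1) ≤ (40/121)·r(n)` for `n ≥ 2`. [cite: ConnesConsani2021, App. F Lemma F.1 (arXiv Lemma 49) proof, arXiv PDF p. 55 (chunk p0035:L98–L102)] -/
theorem rapidDecay_succ_le {k : ℕ} (hk : 2 ≤ k) :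
    remainderTerm (k + 1) / (4 * π * remainderPoly (k + 1))
      ≤ 40 / 121 * (remainderTerm k / (4 * π * remainderPoly k)) := by
  rw [remainderTerm_succ]
  have hp := remainderPoly_pos k
  have hp1 := remainderPoly_pos (k + 1)
  have ha := remainderTerm_pos k
  have hX := ratio_le hk
  have hπ := Real.pi_pos
  have e : remainderTerm k * (4 * π ^ 2 * ((2 * (k : ℝ) + 1) * (2 * k + 2))
      / ((4 * k + 1) * (4 * k + 3) ^ 2 * (4 * k + 5)) * (remainderPoly (k + 1) / remainderPoly k))
      / (4 * π * remainderPoly (k + 1))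
      = 4 * π ^ 2 * ((2 * (k : ℝ) + 1) * (2 * k + 2)) / ((4 * k + 1) * (4 * k + 3) ^ 2 * (4 * k + 5))
        * (remainderTerm k / (4 * π * remainderPoly k)) := by
    field_simp
  rw [e]
  exact mul_le_mul_of_nonneg_right hX (by positivity)

/-- RH-FREE. `r(n) ≤ r(3)` for `n ≥ 3`. [cite: ConnesConsani2021, App. F, chunk p0035:L31 ("Assuming `n ≥ 3`")] -/
theorem rapidDecay_le_three {n : ℕ} (hn : 3 ≤ n) :
    remainderTerm n / (4 * π * remainderPoly n) ≤ remainderTerm 3 / (4 * π * remainderPoly 3) := by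
  induction n, hn using Nat.le_induction with
  | base => exact le_rfl
  | succ k hk ih =>
    have h0 : 0 ≤ remainderTerm k / (4 * π * remainderPoly k) := by
      have := remainderTerm_pos k; have := remainderPoly_pos k; positivity
    calc remainderTerm (k + 1) / (4 * π * remainderPoly (k + 1))
        ≤ 40 / 121 * (remainderTerm k / (4 * π * remainderPoly k)) := rapidDecay_succ_le (by omega)
      _ ≤ remainderTerm k / (4 * π * remainderPoly k) := by linarith
      _ ≤ _ := ih

/-- RH-FREE. `r(3) = 2^{13}·720²/(12!·13‼)·π⁶ ≤ 13/200` (numerically `r(3) ≈ 0.0631`; printed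
`λ(3) = −0.0589766`, §4 p. 16). [cite: ConnesConsani2021, §4 (values of `λ(n)`, chunk p0015); App. F (chunk p0035:L31)] -/
theorem rapidDecay_three_le : remainderTerm 3 / (4 * π * remainderPoly 3) ≤ 13 / 200 := by
  have hp := remainderPoly_pos 3
  have hπ := Real.pi_pos
  have e : remainderTerm 3 / (4 * π * remainderPoly 3) = 2048 / 31216185 * π ^ 6 := by
    rw [remainderTerm]
    norm_num [Nat.factorial, Nat.doubleFactorial]
    field_simp
    ring
  rw [e]
  have h6 : π ^ 6 ≤ (3.15 : ℝ) ^ 6 := pow_le_pow_left₀ hπ.le Real.pi_lt_d2.le 6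
  nlinarith [h6]

/-- RH-FREE. The closing arithmetic of Lemma 49 (i): with `K = 99π/35`, `M₀ = 8n²+(12π+4)n+16π²+12π+3`
(`≥ W₀ + χ`) and `s = √(2n+½)`, `2K(1.0001·M₀ + (134/35)s) ≤ 4π·p(n)·(39831/40000)` for `n ≥ 3`
(coefficientwise, using `3.14 < π < 3.15`, `√2 ≥ 1.41`, `√(4n+1) = √2·s`).
[cite: ConnesConsani2021, App. F Lemma F.1 (arXiv Lemma 49) proof, arXiv PDF p. 55 (chunk p0035:L88–L92)] -/
theorem termwise_arith {n : ℕ} (hn : 3 ≤ n) :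
    2 * (99 * π / 35 * (9801 / 9800 * (8 * (n : ℝ) ^ 2 + (12 * π + 4) * n + 16 * π ^ 2 + 12 * π + 3)
      + 134 / 35 * Real.sqrt (2 * n + 1 / 2)))
      ≤ 4 * π * remainderPoly n * (39831 / 40000) := by
  have hn' : (3 : ℝ) ≤ n := by exact_mod_cast hn
  have hπ := Real.pi_pos
  set s : ℝ := Real.sqrt (2 * n + 1 / 2) with hs
  have hs0 : 0 ≤ s := Real.sqrt_nonneg _
  have hsq2 : Real.sqrt 2 ^ 2 = 2 := Real.sq_sqrt (by norm_num)
  have hsq2pos : 0 ≤ Real.sqrt 2 := Real.sqrt_nonneg 2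
  have hsq2l : 1.41 ≤ Real.sqrt 2 := by nlinarith
  have hsS : Real.sqrt (4 * (n : ℝ) + 1) = Real.sqrt 2 * s := by
    rw [hs, ← Real.sqrt_mul (by norm_num)]; congr 1; ring
  have hp : remainderPoly n = 16 * (n : ℝ) ^ 2 + 8 * (1 + 3 * π) * n
      + (4 * (Real.sqrt 2 * s) + 2 * s) + 32 * π ^ 2 + 24 * π + 2 := by
    rw [remainderPoly, hsS]; linear_combination s * hsq2
  have hcore : 198 / 35 * (9801 / 9800 * (8 * (n : ℝ) ^ 2 + (12 * π + 4) * n + 16 * π ^ 2 + 12 * π + 3)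
      + 134 / 35 * s) ≤ 39831 / 10000 * (16 * (n : ℝ) ^ 2 + 8 * (1 + 3 * π) * n
      + (4 * (Real.sqrt 2 * s) + 2 * s) + 32 * π ^ 2 + 24 * π + 2) := by
    have h3 := Real.pi_gt_d2
    have h4 := Real.pi_lt_d2
    have hn2 : 3 * (n : ℝ) ≤ (n : ℝ) ^ 2 := by nlinarith
    have hπn : 3.14 * (n : ℝ) ≤ π * n := mul_le_mul_of_nonneg_right h3.le (by positivity)
    have hπ2 : 9 ≤ π ^ 2 := by nlinarith
    have hs2s : 1.41 * s ≤ Real.sqrt 2 * s := mul_le_mul_of_nonneg_right hsq2l hs0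
    linarith
  rw [hp]
  have := mul_le_mul_of_nonneg_left hcore hπ.le
  linarith [this]

/-- RH-FREE. The `λ`-smallness used in Lemma 49 (i): `|λ(n)| ≤ r(n) ≤ r(3) ≤ 13/200` for `n ≥ 3`,
hence `1/(1−λ²) ≤ 40000/39831`. [cite: ConnesConsani2021, App. F, chunk p0035:L31; §4 p0016:L36] -/
theorem IsAppEProlateDatum.abs_lam_le_const {n : ℕ} {ψ : ℝ → ℝ} {lam χ : ℝ}
    (d : IsAppEProlateDatum n ψ lam χ) (hn : 3 ≤ n) :
    |lam| ≤ remainderTerm n / (4 * π * remainderPoly n) ∧ lam ^ 2 ≤ 169 / 40000 := by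
  have hr : |lam| ≤ remainderTerm n / (4 * π * remainderPoly n) := by
    rw [← rapidDecay_eq]; exact d.abs_lam_le
  have hlam : |lam| ≤ 13 / 200 := (hr.trans (rapidDecay_le_three hn)).trans rapidDecay_three_le
  exact ⟨hr, by nlinarith [abs_nonneg lam, sq_abs lam]⟩

/-- RH-FREE. (boundAn) made quantitative (App. F (chunk p0035:L5–L45): for `ρ ∈ [1,2]`,
`|√ρ ∫_{ρ⁻¹}^1 D_uψ · D_uη̃(ρ·)| ≤ (99/70)·(2K·(99/280)(W₀+χ))`, `K = 99π/35`.
[cite: ConnesConsani2021, App. F eq. (boundAn), chunk p0035:L45] -/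
theorem IsAppEProlateDatum.abs_integralTerm_le {n : ℕ} {ψ : ℝ → ℝ} {lam χ : ℝ}
    (d : IsAppEProlateDatum n ψ lam χ) (hn : 3 ≤ n) {ρ : ℝ} (hρ1 : 1 ≤ ρ) (hρ2 : ρ ≤ 2) :
    |Real.sqrt ρ * ∫ x in ρ⁻¹..1, scaleDerivIn ψ x * scaleDeriv (cosTransform ψ) (ρ * x)|
      ≤ 99 / 70 * (2 * (99 * π / 35) * (99 / 280 *
        (((2 * (n : ℝ)) ^ 2 + (6 * π + 1) * (2 * n) + 3 * (2 * π + 1) ^ 2) + χ))) := by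
  obtain ⟨hf, hf', hf''c, e1, e2⟩ := hasDerivWithinAt_package d.isProlate
  have hψc : ContinuousOn ψ (Icc (-1) 1) := fun x hx ↦ (hf x hx).continuousWithinAt
  have hf'c : ContinuousOn (derivWithin ψ (Icc (-1) 1)) (Icc (-1) 1) :=
    fun x hx ↦ (hf' x hx).continuousWithinAt
  have hnorm : ∫ x in (-1 : ℝ)..1, ψ x ^ 2 = 1 := by simpa using d.isProlate.norm_one
  have hn' : (3 : ℝ) ≤ n := by exact_mod_cast hn
  have hπ := Real.pi_pos
  set W₀ : ℝ := (2 * (n : ℝ)) ^ 2 + (6 * π + 1) * (2 * n) + 3 * (2 * π + 1) ^ 2 with hW₀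
  set K : ℝ := 99 * π / 35 with hK
  have hW₀pos : 0 < W₀ := by rw [hW₀]; positivity
  have hχ4 : 4 * π ^ 2 ≤ χ := by nlinarith [d.eigen_gt, Real.pi_lt_d2]
  have hη' : ∀ y, |deriv (cosTransform ψ) y| ≤ K := fun y ↦ by
    rw [hK]; exact abs_deriv_cosTransform_le hψc hnorm y
  have hsρ : Real.sqrt ρ ≤ 99 / 70 := by
    rw [show (99 / 70 : ℝ) = Real.sqrt ((99 / 70) ^ 2) by rw [Real.sqrt_sq (by norm_num)]]
    exact Real.sqrt_le_sqrt (by nlinarith)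
  have hρ0 : 0 < ρ := by linarith
  have hρi1 : ρ⁻¹ ≤ 1 := inv_le_one_of_one_le₀ hρ1
  have hρi2 : 1 / 2 ≤ ρ⁻¹ := by rw [one_div]; exact inv_anti₀ hρ0 hρ2
  have hode := ode_Icc_of_eigen d.isProlate d.eigen
  have hwang' : ∫ x in (-1 : ℝ)..1,
      ((1 - x ^ 2) * derivWithin (derivWithin ψ (Icc (-1) 1)) (Icc (-1) 1) x) ^ 2 ≤ W₀ ^ 2 := by
    have hfull : ∫ x in (-1 : ℝ)..1,
          ((1 - x ^ 2) * derivWithin (derivWithin ψ (Icc (-1) 1)) (Icc (-1) 1) x) ^ 2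
        = ∫ x in (-1 : ℝ)..1, ((1 - x ^ 2) * deriv (deriv ψ) x) ^ 2 := by
      refine integral_congr_ae ?_
      have hae : ∀ᵐ x : ℝ, x ≠ 1 := by rw [ae_iff]; simp
      filter_upwards [hae] with x hx1 hx
      rw [uIoc_of_le (by norm_num)] at hx
      rw [e2 x ⟨hx.1, lt_of_le_of_ne hx.2 hx1⟩]
    rw [hfull, hW₀]; exact d.wang
  have hL1 := integral_abs_mul_deriv_le hψc hf'c hf''c hode hχ4 hW₀pos hwang' hnorm hρi2 hρi1
  rw [abs_mul, abs_of_nonneg (Real.sqrt_nonneg _)]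
  refine mul_le_mul hsρ ?_ (abs_nonneg _) (by norm_num)
  have hb : IntervalIntegrable (fun x ↦ 2 * K * |x * derivWithin ψ (Icc (-1) 1) x|) volume ρ⁻¹ 1 := by
    refine ((ContinuousOn.intervalIntegrable ?_).abs).const_mul _
    rw [uIcc_of_le hρi1]
    exact ContinuousOn.mul (by fun_prop) (hf'c.mono (Icc_subset_Icc (by linarith) le_rfl))
  calc |∫ x in ρ⁻¹..1, scaleDerivIn ψ x * scaleDeriv (cosTransform ψ) (ρ * x)|
      ≤ ∫ x in ρ⁻¹..1, 2 * K * |x * derivWithin ψ (Icc (-1) 1) x| := by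
        rw [← Real.norm_eq_abs]
        refine intervalIntegral.norm_integral_le_of_norm_le hρi1 ?_ hb
        refine Eventually.of_forall fun x hx ↦ ?_
        have hx0 : 0 ≤ x := le_trans (by positivity) hx.1.le
        have hρx : |ρ * x| ≤ 2 := by
          rw [abs_of_nonneg (by positivity)]; nlinarith [hx.2]
        rw [Real.norm_eq_abs, scaleDerivIn, scaleDeriv, abs_mul, abs_mul (ρ * x)]
        calc |x * derivWithin ψ (Icc (-1) 1) x| * (|ρ * x| * |deriv (cosTransform ψ) (ρ * x)|)
            ≤ |x * derivWithin ψ (Icc (-1) 1) x| * (2 * K) :=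
              mul_le_mul_of_nonneg_left (mul_le_mul hρx (hη' _) (abs_nonneg _) (by norm_num))
                (abs_nonneg _)
          _ = 2 * K * |x * derivWithin ψ (Icc (-1) 1) x| := by ring
    _ = 2 * K * ∫ x in ρ⁻¹..1, |x * derivWithin ψ (Icc (-1) 1) x| :=
        intervalIntegral.integral_const_mul _ _
    _ ≤ 2 * K * (99 / 280 * (W₀ + χ)) := mul_le_mul_of_nonneg_left hL1 (by positivity)

/-- RH-FREE. (boundBn) made quantitative (App. F (chunk p0035:L49–L74): for `ρ ∈ [1,2]`, with `K = 99π/35` and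
`s = √(2n+½)` ([Rokhlin–Xiao] Thm 12), `|ρ^{-1/2}D_uψ(ρ⁻¹)η̃(1)| ≤ K·s` (proportionality step) and
`|ρ^{1/2}ψ(1)D_uη̃(ρ)| ≤ (99/70)·s·2K`. [cite: ConnesConsani2021, App. F eq. (boundBn), chunk p0035:L74] -/
theorem IsAppEProlateDatum.abs_boundaryTerms_le {n : ℕ} {ψ : ℝ → ℝ} {lam χ : ℝ}
    (d : IsAppEProlateDatum n ψ lam χ) {ρ : ℝ} (hρ1 : 1 ≤ ρ) (hρ2 : ρ ≤ 2) :
    |(Real.sqrt ρ)⁻¹ * scaleDerivIn ψ ρ⁻¹ * cosTransform ψ 1|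
        ≤ 99 * π / 35 * Real.sqrt (2 * n + 1 / 2) ∧
      |Real.sqrt ρ * ψ 1 * scaleDeriv (cosTransform ψ) ρ|
        ≤ 99 / 70 * Real.sqrt (2 * n + 1 / 2) * (2 * (99 * π / 35)) := by
  obtain ⟨hf, -, -, -, -⟩ := hasDerivWithinAt_package d.isProlate
  have hψc : ContinuousOn ψ (Icc (-1) 1) := fun x hx ↦ (hf x hx).continuousWithinAt
  have hnorm : ∫ x in (-1 : ℝ)..1, ψ x ^ 2 = 1 := by simpa using d.isProlate.norm_one
  have hπ := Real.pi_pos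
  set K : ℝ := 99 * π / 35 with hK
  set s : ℝ := Real.sqrt (2 * n + 1 / 2) with hs
  have hη' : ∀ y, |deriv (cosTransform ψ) y| ≤ K := fun y ↦ by
    rw [hK]; exact abs_deriv_cosTransform_le hψc hnorm y
  have hsρ : Real.sqrt ρ ≤ 99 / 70 := by
    rw [show (99 / 70 : ℝ) = Real.sqrt ((99 / 70) ^ 2) by rw [Real.sqrt_sq (by norm_num)]]
    exact Real.sqrt_le_sqrt (by nlinarith)
  have hsρ1 : 1 ≤ Real.sqrt ρ := by
    rw [← Real.sqrt_one]; exact Real.sqrt_le_sqrt hρ1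
  have hρ0 : 0 < ρ := by linarith
  have hρi1 : ρ⁻¹ ≤ 1 := inv_le_one_of_one_le₀ hρ1
  have h1 : |ψ 1| ≤ s := by rw [hs]; exact d.abs_apply_one_lt.le
  constructor
  · have hc1 : cosTransform ψ 1 = lam * ψ 1 := d.cosTransform_eq 1 (by norm_num)
    have hprop := d.lam_mul_derivWithin (y := ρ⁻¹) ⟨by linarith [inv_pos.2 hρ0], hρi1⟩
    have e : (Real.sqrt ρ)⁻¹ * scaleDerivIn ψ ρ⁻¹ * cosTransform ψ 1
        = (Real.sqrt ρ)⁻¹ * ρ⁻¹ * deriv (cosTransform ψ) ρ⁻¹ * ψ 1 := by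
      rw [hc1, scaleDerivIn, ← hprop]; ring
    rw [e, abs_mul, abs_mul, abs_mul, abs_of_pos (by positivity : (0 : ℝ) < (Real.sqrt ρ)⁻¹),
      abs_of_pos (by positivity : (0 : ℝ) < ρ⁻¹)]
    have hi1 : (Real.sqrt ρ)⁻¹ ≤ 1 := inv_le_one_of_one_le₀ hsρ1
    calc (Real.sqrt ρ)⁻¹ * ρ⁻¹ * |deriv (cosTransform ψ) ρ⁻¹| * |ψ 1| ≤ 1 * 1 * K * s :=
          mul_le_mul (mul_le_mul (mul_le_mul hi1 hρi1 (by positivity) (by norm_num)) (hη' _)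
            (abs_nonneg _) (by norm_num)) h1 (abs_nonneg _) (by positivity)
      _ = K * s := by ring
  · rw [scaleDeriv, abs_mul, abs_mul, abs_mul, abs_of_nonneg (Real.sqrt_nonneg _), abs_of_pos hρ0]
    exact mul_le_mul (mul_le_mul hsρ h1 (abs_nonneg _) (by norm_num))
      (mul_le_mul hρ2 (hη' ρ) (abs_nonneg _) (by norm_num)) (by positivity) (by positivity)

/-- RH-FREE. **Lemma 49 (i), termwise form — DISCHARGED**: `|τ(n)T_n(ρ)| ≤ a(n)` for `n ≥ 3`,
`ρ ∈ [1,2]`, for every §4 datum with the imported inequalities (App. F, arXiv PDF pp. 54–55, made quantitative: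
`|η̃′| ≤ 99π/35`, `∫_{ρ⁻¹}^1|D_uψ| ≤ (99/280)(W₀+χ)`, the proportionality step, `λ² ≤ r(3)² ≤ (13/200)²).
[cite: ConnesConsani2021, App. F Lemma F.1 (i) (arXiv Lemma 49), arXiv PDF p. 55 (chunk p0035:L78–L92)] -/
theorem CC2021_lemma_49_termwise_holds : CC2021_lemma_49_termwise := by
  intro n ψ lam χ hn d ρ hρ
  obtain ⟨hρ1, hρ2⟩ := hρ
  have hπ := Real.pi_pos
  have hn' : (3 : ℝ) ≤ n := by exact_mod_cast hn
  have hS1 := d.abs_integralTerm_le hn hρ1 hρ2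
  obtain ⟨hS2, hS3⟩ := d.abs_boundaryTerms_le hρ1 hρ2
  obtain ⟨hr, hlam2⟩ := d.abs_lam_le_const hn
  have harith := termwise_arith hn
  have h1l : 0 < 1 - lam ^ 2 := by linarith [d.sq_lam_lt]
  have hp0 : 0 < remainderPoly n := remainderPoly_pos n
  have hK0 : 0 ≤ 99 * π / 35 := by positivity
  -- `W₀ + χ ≤ M₀`
  have hM : ((2 * (n : ℝ)) ^ 2 + (6 * π + 1) * (2 * n) + 3 * (2 * π + 1) ^ 2) + χ
      ≤ 8 * (n : ℝ) ^ 2 + (12 * π + 4) * n + 16 * π ^ 2 + 12 * π + 3 := by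
    nlinarith [d.eigen_lt]
  have hM' := mul_le_mul_of_nonneg_left hM (by positivity : (0 : ℝ) ≤ 99 * π / 35 * (9801 / 9800))
  have hlast : 4 * π * remainderPoly n * (39831 / 40000) ≤ 4 * π * remainderPoly n * (1 - lam ^ 2) :=
    mul_le_mul_of_nonneg_left (by linarith) (by positivity)
  have htri := (abs_sub (Real.sqrt ρ * (∫ x in ρ⁻¹..1, scaleDerivIn ψ x * scaleDeriv (cosTransform ψ) (ρ * x))
      + (Real.sqrt ρ)⁻¹ * scaleDerivIn ψ ρ⁻¹ * cosTransform ψ 1)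
      (Real.sqrt ρ * ψ 1 * scaleDeriv (cosTransform ψ) ρ)).trans
    (add_le_add (abs_add_le _ _) le_rfl)
  have hS : |Real.sqrt ρ * (∫ x in ρ⁻¹..1, scaleDerivIn ψ x * scaleDeriv (cosTransform ψ) (ρ * x))
        + (Real.sqrt ρ)⁻¹ * scaleDerivIn ψ ρ⁻¹ * cosTransform ψ 1
        - Real.sqrt ρ * ψ 1 * scaleDeriv (cosTransform ψ) ρ|
      ≤ 4 * π * remainderPoly n * (1 - lam ^ 2) / 2 := by
    linarith [htri, hS1, hS2, hS3, hM', harith, hlast]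
  rw [sonineQTerm, abs_mul, abs_div, abs_mul, abs_two, abs_of_pos h1l]
  calc 2 * |lam| / (1 - lam ^ 2) * _
      ≤ 2 * |lam| / (1 - lam ^ 2) * (4 * π * remainderPoly n * (1 - lam ^ 2) / 2) :=
        mul_le_mul_of_nonneg_left hS (by positivity)
    _ = |lam| * (4 * π * remainderPoly n) := by field_simp
    _ ≤ remainderTerm n / (4 * π * remainderPoly n) * (4 * π * remainderPoly n) :=
        mul_le_mul_of_nonneg_right hr (by positivity)
    _ = remainderTerm n := by field_simp

/-- RH-FREE. **Lemma 49 (i) = (computersafe), fact-free** (`N ≥ 2`): for §4 data satisfying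
`IsAppEProlateDatum` beyond `N` and `ρ ∈ [1,2]`, `Σ_{n>N} τ(n)T_n(ρ)` converges absolutely and
`|Σ_{n>N} τ(n)T_n(ρ)| ≤ Σ_{n>N} a(n)`. [cite: ConnesConsani2021, App. F Lemma F.1 (i) (arXiv Lemma 49), arXiv PDF p. 55 (chunk p0035:L78–L81)] -/
theorem CC2021_lemma_49_i_holds {N : ℕ} (hN : 2 ≤ N)
    {ψ : ℕ → ℝ → ℝ} {lam χ : ℕ → ℝ} (hd : ∀ n, N < n → IsAppEProlateDatum n (ψ n) (lam n) (χ n))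
    {ρ : ℝ} (hρ : ρ ∈ Icc (1 : ℝ) 2) :
    Summable (fun k : ℕ ↦ sonineQTerm (ψ (k + (N + 1))) (lam (k + (N + 1))) ρ) ∧
      |∑' k : ℕ, sonineQTerm (ψ (k + (N + 1))) (lam (k + (N + 1))) ρ|
        ≤ ∑' k : ℕ, remainderTerm (k + (N + 1)) :=
  CC2021_lemma_49_i CC2021_lemma_49_termwise_holds hN hd hρ

/-- RH-FREE. **Lemma 49 (ii) = (computersafe1) modulo the printed number only**: for §4 data beyond
`N = 10` and `ρ ∈ [1,2]`, `|Σ_{n ≥ 11} τ(n)T_n(ρ)| ≤ 2.366·10^{-12}`, conditional on nothing but the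
NUMERICAL-IN-PRINT inequality `CC2021_lemma_49_ii_tail`.
[cite: ConnesConsani2021, App. F Lemma F.1 (ii) (arXiv Lemma 49), arXiv PDF p. 55 (chunk p0035:L82–L85)] -/
theorem CC2021_lemma_49_ii_of_tail (hnum : CC2021_lemma_49_ii_tail)
    {ψ : ℕ → ℝ → ℝ} {lam χ : ℕ → ℝ} (hd : ∀ n, 10 < n → IsAppEProlateDatum n (ψ n) (lam n) (χ n))
    {ρ : ℝ} (hρ : ρ ∈ Icc (1 : ℝ) 2) :
    Summable (fun k : ℕ ↦ sonineQTerm (ψ (k + 11)) (lam (k + 11)) ρ) ∧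
      |∑' k : ℕ, sonineQTerm (ψ (k + 11)) (lam (k + 11)) ρ| ≤ (2.366e-12 : ℝ) :=
  CC2021_lemma_49_ii CC2021_lemma_49_termwise_holds hnum hd hρ

/-! ## Discharge of the printed number `CC2021_lemma_49_ii_tail` by certified arithmetic

`Σ_{n≥11} a(n) = a(11) + a(12) + Σ_{n≥13} a(n) ≤ 2.353248·10^{-12} + 1.1982·10^{-14} + (100/99)·5.143·10^{-17}
< 2.366·10^{-12}`, using `π ≤ 3.141593`, `√2 ≤ 1.4143`, `√45 ≤ 6.7083`, `√49 ≤ 7`, `√53 ≤ 7.2802`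
and `a(n+1) ≤ a(n)/100` for `n ≥ 13` (the printed proof: terms `11..34` "simply computed", tail
`≤ 10^{-80}` by a geometric bound, p0035:L94–L110). -/

/-- RH-FREE. `a(n+1) ≤ a(n)/100` for `n ≥ 13` (cf. the printed `n²ν_{n+1}/ν_n < 1`, p0035:L102).
[cite: ConnesConsani2021, App. F Lemma F.1 (arXiv Lemma 49) proof, arXiv PDF p. 55 (chunk p0035:L98–L105)] -/
theorem remainderTerm_succ_le_sharp {n : ℕ} (hn : 13 ≤ n) :
    remainderTerm (n + 1) ≤ 1 / 100 * remainderTerm n := by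
  have hn' : (13 : ℝ) ≤ n := by exact_mod_cast hn
  have ha : 0 < remainderTerm n := remainderTerm_pos n
  have hp : 0 < remainderPoly n := remainderPoly_pos n
  have hY : remainderPoly (n + 1) / remainderPoly n ≤ 9 / 4 := by
    rw [div_le_iff₀ hp]; exact remainderPoly_succ_le (by omega)
  have hY0 : 0 ≤ remainderPoly (n + 1) / remainderPoly n := by
    have := remainderPoly_pos (n + 1); positivity
  have hX : 4 * π ^ 2 * ((2 * (n : ℝ) + 1) * (2 * n + 2)) / ((4 * n + 1) * (4 * n + 3) ^ 2 * (4 * n + 5))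
      ≤ 1 / 225 := by
    rw [div_le_div_iff₀ (by positivity) (by positivity)]
    have hπ : π ^ 2 < 10 := by nlinarith [Real.pi_lt_d2, Real.pi_pos]
    have h1 : 15 * ((2 * (n : ℝ) + 1) * (2 * n + 2)) ≤ 4 * ((4 * n + 1) * (4 * n + 5)) := by nlinarith
    have h2 : (3025 : ℝ) ≤ (4 * n + 3) ^ 2 := by nlinarith
    have hP0 : (0 : ℝ) ≤ (2 * (n : ℝ) + 1) * (2 * n + 2) := by positivity
    have hA : 15 * ((2 * (n : ℝ) + 1) * (2 * n + 2)) * 3025 ≤ 4 * ((4 * n + 1) * (4 * n + 5)) * (4 * n + 3) ^ 2 :=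
      mul_le_mul h1 h2 (by norm_num) (by positivity)
    nlinarith [mul_nonneg (sub_nonneg.2 hπ.le) hP0, hA]
  rw [remainderTerm_succ]
  calc remainderTerm n * (4 * π ^ 2 * ((2 * (n : ℝ) + 1) * (2 * n + 2))
        / ((4 * n + 1) * (4 * n + 3) ^ 2 * (4 * n + 5)) * (remainderPoly (n + 1) / remainderPoly n))
      ≤ remainderTerm n * (1 / 225 * (9 / 4)) :=
        mul_le_mul_of_nonneg_left (mul_le_mul hX hY hY0 (by norm_num)) ha.le
    _ = 1 / 100 * remainderTerm n := by ring

/-- RH-FREE. Rational enclosure of `a(n)` from upper bounds for `π`, `√2`, `√(4n+1)`.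
[cite: ConnesConsani2021, App. F Lemma F.1 (ii) (arXiv Lemma 49) proof, arXiv PDF p. 55 (chunk p0035:L106–L109)] -/
theorem remainderTerm_le_of_bounds (n : ℕ) {πhi s₂ sₙ : ℝ} (hπ : π ≤ πhi)
    (hs₂ : Real.sqrt 2 ≤ s₂) (hsₙ : Real.sqrt (4 * n + 1) ≤ sₙ) :
    remainderTerm n ≤ 2 ^ (4 * n + 3) * πhi ^ (2 * n + 1)
      * (16 * (n : ℝ) ^ 2 + 8 * (1 + 3 * πhi) * n + (4 + s₂) * sₙ + 32 * πhi ^ 2 + 24 * πhi + 2)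
      * ((2 * n)! : ℝ) ^ 2 / ((4 * n)! * ((4 * n + 1)‼ : ℕ) : ℝ) := by
  have hπ0 := Real.pi_pos
  have hs2 : 0 ≤ Real.sqrt 2 := Real.sqrt_nonneg 2
  have hsn : 0 ≤ Real.sqrt (4 * n + 1) := Real.sqrt_nonneg _
  have hp : remainderPoly n ≤
      16 * (n : ℝ) ^ 2 + 8 * (1 + 3 * πhi) * n + (4 + s₂) * sₙ + 32 * πhi ^ 2 + 24 * πhi + 2 := by
    unfold remainderPoly
    have h1 : (4 + Real.sqrt 2) * Real.sqrt (4 * n + 1) ≤ (4 + s₂) * sₙ :=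
      mul_le_mul (by linarith) hsₙ hsn (by linarith)
    nlinarith [mul_le_mul hπ hπ hπ0.le (hπ0.le.trans hπ)]
  have hpow : π ^ (2 * n + 1) ≤ πhi ^ (2 * n + 1) := pow_le_pow_left₀ hπ0.le hπ _
  have hp0 := (remainderPoly_pos n).le
  unfold remainderTerm
  have hden : (0 : ℝ) < ((4 * n)! * ((4 * n + 1)‼ : ℕ) : ℝ) := by
    have := Nat.doubleFactorial_pos (4 * n + 1); positivity
  rw [div_le_div_iff_of_pos_right hden]
  have h0 : (0 : ℝ) ≤ 2 ^ (4 * n + 3) * πhi ^ (2 * n + 1) :=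
    mul_nonneg (by positivity) (le_trans (by positivity) hpow)
  calc 2 ^ (4 * n + 3) * π ^ (2 * n + 1) * remainderPoly n * ((2 * n)! : ℝ) ^ 2
      ≤ 2 ^ (4 * n + 3) * πhi ^ (2 * n + 1) * remainderPoly n * ((2 * n)! : ℝ) ^ 2 := by
        gcongr
    _ ≤ _ := by
        gcongr

/-- RH-FREE. `√x ≤ y` from `x ≤ y²`, `0 ≤ y`. [folklore] -/
private theorem sqrt_le_of_sq_le' {x y : ℝ} (hy : 0 ≤ y) (h : x ≤ y ^ 2) : Real.sqrt x ≤ y := by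
  calc Real.sqrt x ≤ Real.sqrt (y ^ 2) := Real.sqrt_le_sqrt h
    _ = y := Real.sqrt_sq hy

/-- RH-FREE. `a(11) ≤ 2.353248·10^{-12}` (printed contribution: the terms `11..34` sum to
`∼ 2.365·10^{-12}`, p0035:L108). [cite: ConnesConsani2021, App. F Lemma F.1 (ii) (arXiv Lemma 49) proof, arXiv PDF p. 55 (chunk p0035:L106–L109)] -/
theorem remainderTerm_eleven_le : remainderTerm 11 ≤ (2.353248e-12 : ℝ) := by
  have h := remainderTerm_le_of_bounds 11 Real.pi_lt_d6.le
    (sqrt_le_of_sq_le' (y := 1.4143) (by norm_num) (by norm_num))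
    (sqrt_le_of_sq_le' (y := 6.7083) (by norm_num) (by norm_num))
  refine h.trans ?_
  norm_num [Nat.factorial, Nat.doubleFactorial]

/-- RH-FREE. `a(12) ≤ 1.1982·10^{-14}`. [cite: ConnesConsani2021, App. F Lemma F.1 (ii) (arXiv Lemma 49) proof, arXiv PDF p. 55 (chunk p0035:L106–L109)] -/
theorem remainderTerm_twelve_le : remainderTerm 12 ≤ (1.1982e-14 : ℝ) := by
  have h := remainderTerm_le_of_bounds 12 Real.pi_lt_d6.le
    (sqrt_le_of_sq_le' (y := 1.4143) (by norm_num) (by norm_num))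
    (sqrt_le_of_sq_le' (y := 7) (by norm_num) (by norm_num))
  refine h.trans ?_
  norm_num [Nat.factorial, Nat.doubleFactorial]

/-- RH-FREE. `a(13) ≤ 5.143·10^{-17}`. [cite: ConnesConsani2021, App. F Lemma F.1 (ii) (arXiv Lemma 49) proof, arXiv PDF p. 55 (chunk p0035:L106–L109)] -/
theorem remainderTerm_thirteen_le : remainderTerm 13 ≤ (5.143e-17 : ℝ) := by
  have h := remainderTerm_le_of_bounds 13 Real.pi_lt_d6.le
    (sqrt_le_of_sq_le' (y := 1.4143) (by norm_num) (by norm_num))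
    (sqrt_le_of_sq_le' (y := 7.2802) (by norm_num) (by norm_num))
  refine h.trans ?_
  norm_num [Nat.factorial, Nat.doubleFactorial]

/-- NUMERICAL-IN-PRINT, now CERTIFIED (RH-FREE). **Lemma 49 (ii), the printed number — DISCHARGED**:
`Σ_{n≥11} a(n) ≤ 2.366·10^{-12}`, by `a(11) + a(12) + (100/99)·a(13)` with the rational enclosures above
(kernel arithmetic with `π ≤ 3.141593`; the source's "one then simply computes the missing terms").
[cite: ConnesConsani2021, App. F Lemma F.1 (ii) (arXiv Lemma 49), arXiv PDF p. 55 (chunk p0035:L82–L85, L94–L110)] -/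
theorem CC2021_lemma_49_ii_tail_holds : CC2021_lemma_49_ii_tail := by
  unfold CC2021_lemma_49_ii_tail
  have hs : Summable remainderTerm := summable_remainderTerm
  have hs11 : Summable (fun k : ℕ ↦ remainderTerm (k + 11)) := (summable_nat_add_iff 11).2 hs
  have hs13 : Summable (fun k : ℕ ↦ remainderTerm (k + 13)) := (summable_nat_add_iff 13).2 hs
  have h13 : ∀ k : ℕ, remainderTerm (k + 13) ≤ remainderTerm 13 * (1 / 100) ^ k := by
    intro k
    induction k with
    | zero => simp
    | succ k ih =>
      calc remainderTerm (k + 1 + 13) = remainderTerm ((k + 13) + 1) := by ring_nf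
        _ ≤ 1 / 100 * remainderTerm (k + 13) := remainderTerm_succ_le_sharp (by omega)
        _ ≤ 1 / 100 * (remainderTerm 13 * (1 / 100) ^ k) := by gcongr
        _ = remainderTerm 13 * (1 / 100) ^ (k + 1) := by ring
  have hg : HasSum (fun k : ℕ ↦ remainderTerm 13 * (1 / 100 : ℝ) ^ k)
      (remainderTerm 13 * (1 - 1 / 100)⁻¹) :=
    (hasSum_geometric_of_lt_one (by norm_num) (by norm_num)).mul_left _
  have htail : ∑' k : ℕ, remainderTerm (k + 13) ≤ remainderTerm 13 * (100 / 99) := by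
    calc ∑' k : ℕ, remainderTerm (k + 13) ≤ ∑' k : ℕ, remainderTerm 13 * (1 / 100 : ℝ) ^ k :=
          Summable.tsum_le_tsum h13 hs13 hg.summable
      _ = remainderTerm 13 * (1 - 1 / 100)⁻¹ := hg.tsum_eq
      _ = remainderTerm 13 * (100 / 99) := by norm_num
  have hsplit : ∑' k : ℕ, remainderTerm (k + 11)
      = remainderTerm 11 + remainderTerm 12 + ∑' k : ℕ, remainderTerm (k + 13) := by
    rw [← Summable.sum_add_tsum_nat_add 2 hs11]
    simp only [Finset.sum_range_succ, Finset.sum_range_zero, zero_add, add_assoc]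
  rw [hsplit]
  have h11 := remainderTerm_eleven_le
  have h12 := remainderTerm_twelve_le
  have h13' := remainderTerm_thirteen_le
  have h13pos := (remainderTerm_pos 13).le
  nlinarith [htail]

/-- RH-FREE. **Lemma 49 (ii) = (computersafe1), FACT-FREE**: for §4 data satisfying `IsAppEProlateDatum`
beyond `N = 10` and every `ρ ∈ [1,2]`, `Σ_{n≥11} τ(n)T_n(ρ)` converges absolutely and
`|Σ_{n ≥ 11} τ(n)T_n(ρ)| ≤ 2.366·10^{-12}` (= `|Qε(ρ) − Σ_0^{10} τ(k)T_k(ρ)|` by Prop. 5.3).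
[cite: ConnesConsani2021, App. F Lemma F.1 (ii) (arXiv Lemma 49) eq. (computersafe1), arXiv PDF p. 55 (chunk p0035:L82–L85)] -/
theorem CC2021_lemma_49_ii_holds
    {ψ : ℕ → ℝ → ℝ} {lam χ : ℕ → ℝ} (hd : ∀ n, 10 < n → IsAppEProlateDatum n (ψ n) (lam n) (χ n))
    {ρ : ℝ} (hρ : ρ ∈ Icc (1 : ℝ) 2) :
    Summable (fun k : ℕ ↦ sonineQTerm (ψ (k + 11)) (lam (k + 11)) ρ) ∧
      |∑' k : ℕ, sonineQTerm (ψ (k + 11)) (lam (k + 11)) ρ| ≤ (2.366e-12 : ℝ) :=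
  CC2021_lemma_49_ii CC2021_lemma_49_termwise_holds CC2021_lemma_49_ii_tail_holds hd hρ

/-- RH-FREE. [Rokhlin–Xiao 2007, Thm 12] in CC units (cell ruling R9): for the tree-normalised
`ψ` (`∫_{-1}^1ψ² = 1`) with `|ψ(1)| < √(2n+½)`, CC's `ξ_n = √2·ψ` (`∫_0^1 ξ_n² = 1`) satisfies
`|ξ_n(1)| < √(4n+1)` — NOT the printed (Rokh) `√(2n+½)` (module docstring, ERRATA 1).
[cite: RokhlinXiao2007, Thm. 12 p. 116] -/
theorem abs_sqrt_two_mul_apply_one_lt {n : ℕ} {ψ : ℝ → ℝ}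
    (h : |ψ 1| < Real.sqrt (2 * n + 1 / 2)) :
    |Real.sqrt 2 * ψ 1| < Real.sqrt (4 * n + 1) := by
  rw [abs_mul, abs_of_nonneg (Real.sqrt_nonneg 2),
    show (4 * (n : ℝ) + 1) = 2 * (2 * n + 1 / 2) by ring, Real.sqrt_mul (by norm_num : (0:ℝ) ≤ 2)]
  exact mul_lt_mul_of_pos_left h (Real.sqrt_pos.2 (by norm_num))

/-! ## Termwise bounds for the `ε`-series itself (the kernel `k(ρ) = ρ^{1/2}∫_{ρ⁻¹}^1 ξ_n(x)ζ_n(ρx)dx`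
of Thm. 4.7 / Prop. 5.3 / Lemma 5.4, in tree normalisation `√ρ∫_{ρ⁻¹}^1 ψ(t)η̃(ρt)dt`, and the three
pieces of `(ρ∂_ρ)k` displayed in the proof of Lemma 5.2 (arXiv Lemma 29, chunk p0019:L80)) — RH-FREE
helper estimates for the `C²` regularity of the density (route binder K0), all `≤ poly(n)`, to be
multiplied by `|2λ/(1−λ²)| ≤ (80000/39831)·r(n)`, `r(n) = a(n)/(4πp(n))`. -/

/-- RH-FREE. `|η̃(y)| ≤ ∫_{-1}^1|ψ| ≤ 99/70` for `ψ` continuous on `[−1,1]` with `∫ψ² = 1`.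
[cite: ConnesConsani2021, §5 Lemma 5.4 proof (arXiv item 31), chunk p0020:L91–L98] -/
theorem abs_cosTransform_le {ψ : ℝ → ℝ} (hψ : ContinuousOn ψ (Icc (-1) 1))
    (h1 : ∫ x in (-1 : ℝ)..1, ψ x ^ 2 = 1) (y : ℝ) : |cosTransform ψ y| ≤ 99 / 70 := by
  have hI : uIcc (-1 : ℝ) 1 = Icc (-1) 1 := uIcc_of_le (by norm_num)
  have hb : IntervalIntegrable (fun x ↦ |ψ x|) volume (-1) 1 := by
    apply ContinuousOn.intervalIntegrable; rw [hI]; exact hψ.abs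
  unfold cosTransform
  calc |∫ x in (-1 : ℝ)..1, ψ x * Real.cos (2 * π * x * y)| ≤ ∫ x in (-1 : ℝ)..1, |ψ x| := by
        rw [← Real.norm_eq_abs]
        refine intervalIntegral.norm_integral_le_of_norm_le (by norm_num) ?_ hb
        refine Eventually.of_forall fun x _ ↦ ?_
        rw [Real.norm_eq_abs, abs_mul]
        exact mul_le_of_le_one_right (abs_nonneg _) (Real.abs_cos_le_one _)
    _ ≤ 99 / 70 := integral_abs_le_of_sq_one hψ h1

/-- RH-FREE. The `ε`-kernel itself: `|√ρ ∫_{ρ⁻¹}^1 ψ(t) η̃(ρt) dt| ≤ (99/70)³` for `ρ ∈ [1,2]`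
(`√ρ ≤ 99/70`, `|η̃| ≤ 99/70`, `∫|ψ| ≤ 99/70`).
[cite: ConnesConsani2021, Thm. 4.7 eq. (sonine0) (arXiv item 27), chunk p0018:L33–L40] -/
theorem IsAppEProlateDatum.abs_epsKernel_le {n : ℕ} {ψ : ℝ → ℝ} {lam χ : ℝ}
    (d : IsAppEProlateDatum n ψ lam χ) {ρ : ℝ} (hρ1 : 1 ≤ ρ) (hρ2 : ρ ≤ 2) :
    |Real.sqrt ρ * ∫ t in ρ⁻¹..1, ψ t * cosTransform ψ (ρ * t)| ≤ (99 / 70) ^ 3 := by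
  obtain ⟨hf, -, -, -, -⟩ := hasDerivWithinAt_package d.isProlate
  have hψc : ContinuousOn ψ (Icc (-1) 1) := fun x hx ↦ (hf x hx).continuousWithinAt
  have hnorm : ∫ x in (-1 : ℝ)..1, ψ x ^ 2 = 1 := by simpa using d.isProlate.norm_one
  have hρ0 : 0 < ρ := by linarith
  have hρi1 : ρ⁻¹ ≤ 1 := inv_le_one_of_one_le₀ hρ1
  have hsρ : Real.sqrt ρ ≤ 99 / 70 := by
    rw [show (99 / 70 : ℝ) = Real.sqrt ((99 / 70) ^ 2) by rw [Real.sqrt_sq (by norm_num)]]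
    exact Real.sqrt_le_sqrt (by nlinarith)
  have hsub : Icc ρ⁻¹ 1 ⊆ Icc (-1 : ℝ) 1 := Icc_subset_Icc (by linarith [inv_pos.2 hρ0]) le_rfl
  have hb : IntervalIntegrable (fun t ↦ 99 / 70 * |ψ t|) volume ρ⁻¹ 1 := by
    apply ContinuousOn.intervalIntegrable; rw [uIcc_of_le hρi1]
    exact continuousOn_const.mul (hψc.abs.mono hsub)
  have hb1 : IntervalIntegrable (fun t ↦ |ψ t|) volume (-1) 1 := by
    apply ContinuousOn.intervalIntegrable; rw [uIcc_of_le (by norm_num)]; exact hψc.abs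
  have hint : |∫ t in ρ⁻¹..1, ψ t * cosTransform ψ (ρ * t)| ≤ 99 / 70 * (99 / 70) := by
    calc |∫ t in ρ⁻¹..1, ψ t * cosTransform ψ (ρ * t)| ≤ ∫ t in ρ⁻¹..1, 99 / 70 * |ψ t| := by
          rw [← Real.norm_eq_abs]
          refine intervalIntegral.norm_integral_le_of_norm_le hρi1 ?_ hb
          refine Eventually.of_forall fun t _ ↦ ?_
          rw [Real.norm_eq_abs, abs_mul, mul_comm]
          exact mul_le_mul_of_nonneg_right (abs_cosTransform_le hψc hnorm _) (abs_nonneg _)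
      _ = 99 / 70 * ∫ t in ρ⁻¹..1, |ψ t| := intervalIntegral.integral_const_mul _ _
      _ ≤ 99 / 70 * (99 / 70) := by
          gcongr
          calc ∫ t in ρ⁻¹..1, |ψ t| ≤ ∫ t in (-1 : ℝ)..1, |ψ t| :=
                intervalIntegral.integral_mono_interval (by linarith [inv_pos.2 hρ0]) hρi1 le_rfl
                  (Eventually.of_forall fun t ↦ abs_nonneg _) hb1
            _ ≤ 99 / 70 := integral_abs_le_of_sq_one hψc hnorm
  rw [abs_mul, abs_of_nonneg (Real.sqrt_nonneg _)]
  calc Real.sqrt ρ * |∫ t in ρ⁻¹..1, ψ t * cosTransform ψ (ρ * t)| ≤ 99 / 70 * (99 / 70 * (99 / 70)) :=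
        mul_le_mul hsρ hint (abs_nonneg _) (by norm_num)
    _ = (99 / 70) ^ 3 := by ring

/-- RH-FREE. The boundary piece of `(ρ∂_ρ)k`: `|ρ^{-1/2} ψ(ρ⁻¹) η̃(1)| ≤ (99/70)·√(2n+½)` for `ρ ≥ 1`
(proportionality `ψ(ρ⁻¹)η̃(1) = η̃(ρ⁻¹)ψ(1)` by (chirem0.5), then `|η̃| ≤ 99/70`, [Rokhlin–Xiao] Thm 12).
[cite: ConnesConsani2021, §5 Lemma 5.2 proof (arXiv item 29), chunk p0019:L80] -/
theorem IsAppEProlateDatum.abs_epsKernel_boundary_le {n : ℕ} {ψ : ℝ → ℝ} {lam χ : ℝ}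
    (d : IsAppEProlateDatum n ψ lam χ) {ρ : ℝ} (hρ1 : 1 ≤ ρ) :
    |(Real.sqrt ρ)⁻¹ * ψ ρ⁻¹ * cosTransform ψ 1| ≤ 99 / 70 * Real.sqrt (2 * n + 1 / 2) := by
  obtain ⟨hf, -, -, -, -⟩ := hasDerivWithinAt_package d.isProlate
  have hψc : ContinuousOn ψ (Icc (-1) 1) := fun x hx ↦ (hf x hx).continuousWithinAt
  have hnorm : ∫ x in (-1 : ℝ)..1, ψ x ^ 2 = 1 := by simpa using d.isProlate.norm_one
  have hρ0 : 0 < ρ := by linarith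
  have hρi1 : ρ⁻¹ ≤ 1 := inv_le_one_of_one_le₀ hρ1
  have hsρ1 : 1 ≤ Real.sqrt ρ := by rw [← Real.sqrt_one]; exact Real.sqrt_le_sqrt hρ1
  have hi1 : (Real.sqrt ρ)⁻¹ ≤ 1 := inv_le_one_of_one_le₀ hsρ1
  have hc1 : cosTransform ψ 1 = lam * ψ 1 := d.cosTransform_eq 1 (by norm_num)
  have hcρ : cosTransform ψ ρ⁻¹ = lam * ψ ρ⁻¹ :=
    d.cosTransform_eq ρ⁻¹ ⟨by linarith [inv_pos.2 hρ0], hρi1⟩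
  have e : (Real.sqrt ρ)⁻¹ * ψ ρ⁻¹ * cosTransform ψ 1
      = (Real.sqrt ρ)⁻¹ * cosTransform ψ ρ⁻¹ * ψ 1 := by rw [hc1, hcρ]; ring
  rw [e, abs_mul, abs_mul, abs_of_pos (by positivity : (0 : ℝ) < (Real.sqrt ρ)⁻¹)]
  calc (Real.sqrt ρ)⁻¹ * |cosTransform ψ ρ⁻¹| * |ψ 1| ≤ 1 * (99 / 70) * Real.sqrt (2 * n + 1 / 2) :=
        mul_le_mul (mul_le_mul hi1 (abs_cosTransform_le hψc hnorm _) (abs_nonneg _) (by norm_num))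
          d.abs_apply_one_lt.le (abs_nonneg _) (by positivity)
    _ = 99 / 70 * Real.sqrt (2 * n + 1 / 2) := by ring

/-- RH-FREE. The integral piece of `(ρ∂_ρ)k`: `|√ρ ∫_{ρ⁻¹}^1 ψ(t)(D_uη̃)(ρt)dt| ≤ (99/70)²·(2·99π/35)` for
`ρ ∈ [1,2]` (`|ρt·η̃′(ρt)| ≤ 2·99π/35`). [cite: ConnesConsani2021, §5 Lemma 5.2 proof (arXiv item 29), chunk p0019:L80] -/
theorem IsAppEProlateDatum.abs_epsKernel_derivIntegral_le {n : ℕ} {ψ : ℝ → ℝ} {lam χ : ℝ}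
    (d : IsAppEProlateDatum n ψ lam χ) {ρ : ℝ} (hρ1 : 1 ≤ ρ) (hρ2 : ρ ≤ 2) :
    |Real.sqrt ρ * ∫ t in ρ⁻¹..1, ψ t * scaleDeriv (cosTransform ψ) (ρ * t)|
      ≤ (99 / 70) ^ 2 * (2 * (99 * π / 35)) := by
  obtain ⟨hf, -, -, -, -⟩ := hasDerivWithinAt_package d.isProlate
  have hψc : ContinuousOn ψ (Icc (-1) 1) := fun x hx ↦ (hf x hx).continuousWithinAt
  have hnorm : ∫ x in (-1 : ℝ)..1, ψ x ^ 2 = 1 := by simpa using d.isProlate.norm_one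
  have hπ := Real.pi_pos
  have hρ0 : 0 < ρ := by linarith
  have hρi1 : ρ⁻¹ ≤ 1 := inv_le_one_of_one_le₀ hρ1
  have hsρ : Real.sqrt ρ ≤ 99 / 70 := by
    rw [show (99 / 70 : ℝ) = Real.sqrt ((99 / 70) ^ 2) by rw [Real.sqrt_sq (by norm_num)]]
    exact Real.sqrt_le_sqrt (by nlinarith)
  have hsub : Icc ρ⁻¹ 1 ⊆ Icc (-1 : ℝ) 1 := Icc_subset_Icc (by linarith [inv_pos.2 hρ0]) le_rfl
  set K : ℝ := 99 * π / 35 with hK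
  have hη' : ∀ y, |deriv (cosTransform ψ) y| ≤ K := fun y ↦ by
    rw [hK]; exact abs_deriv_cosTransform_le hψc hnorm y
  have hb : IntervalIntegrable (fun t ↦ 2 * K * |ψ t|) volume ρ⁻¹ 1 := by
    apply ContinuousOn.intervalIntegrable; rw [uIcc_of_le hρi1]
    exact continuousOn_const.mul (hψc.abs.mono hsub)
  have hb1 : IntervalIntegrable (fun t ↦ |ψ t|) volume (-1) 1 := by
    apply ContinuousOn.intervalIntegrable; rw [uIcc_of_le (by norm_num)]; exact hψc.abs
  have hint : |∫ t in ρ⁻¹..1, ψ t * scaleDeriv (cosTransform ψ) (ρ * t)| ≤ 2 * K * (99 / 70) := by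
    calc |∫ t in ρ⁻¹..1, ψ t * scaleDeriv (cosTransform ψ) (ρ * t)| ≤ ∫ t in ρ⁻¹..1, 2 * K * |ψ t| := by
          rw [← Real.norm_eq_abs]
          refine intervalIntegral.norm_integral_le_of_norm_le hρi1 ?_ hb
          refine Eventually.of_forall fun t ht ↦ ?_
          have ht0 : 0 ≤ t := le_trans (by positivity) ht.1.le
          have hρt : |ρ * t| ≤ 2 := by rw [abs_of_nonneg (by positivity)]; nlinarith [ht.2]
          rw [Real.norm_eq_abs, abs_mul, scaleDeriv, abs_mul (ρ * t), mul_comm]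
          exact mul_le_mul_of_nonneg_right (mul_le_mul hρt (hη' _) (abs_nonneg _) (by norm_num))
            (abs_nonneg _)
      _ = 2 * K * ∫ t in ρ⁻¹..1, |ψ t| := intervalIntegral.integral_const_mul _ _
      _ ≤ 2 * K * (99 / 70) := by
          gcongr
          calc ∫ t in ρ⁻¹..1, |ψ t| ≤ ∫ t in (-1 : ℝ)..1, |ψ t| :=
                intervalIntegral.integral_mono_interval (by linarith [inv_pos.2 hρ0]) hρi1 le_rfl
                  (Eventually.of_forall fun t ↦ abs_nonneg _) hb1
            _ ≤ 99 / 70 := integral_abs_le_of_sq_one hψc hnorm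
  rw [abs_mul, abs_of_nonneg (Real.sqrt_nonneg _)]
  calc Real.sqrt ρ * |∫ t in ρ⁻¹..1, ψ t * scaleDeriv (cosTransform ψ) (ρ * t)|
      ≤ 99 / 70 * (2 * K * (99 / 70)) := mul_le_mul hsρ hint (abs_nonneg _) (by norm_num)
    _ = (99 / 70) ^ 2 * (2 * K) := by ring

/-- RH-FREE. The coefficient of the `n`-th `ε`-term: `|2λ/(1−λ²)| ≤ (80000/39831)·r(n)`, `r(n) = a(n)/(4πp(n))`
(`n ≥ 3`; `λ² ≤ 169/40000`). [cite: ConnesConsani2021, App. F Lemma F.1 (arXiv Lemma 49) proof, arXiv PDF p. 55 (chunk p0035:L87–L92)] -/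
theorem IsAppEProlateDatum.abs_coeff_le {n : ℕ} {ψ : ℝ → ℝ} {lam χ : ℝ}
    (d : IsAppEProlateDatum n ψ lam χ) (hn : 3 ≤ n) :
    |2 * lam / (1 - lam ^ 2)| ≤ 80000 / 39831 * (remainderTerm n / (4 * π * remainderPoly n)) := by
  obtain ⟨hr, hlam2⟩ := d.abs_lam_le_const hn
  have h1l : 0 < 1 - lam ^ 2 := by linarith [d.sq_lam_lt]
  rw [abs_div, abs_mul, abs_two, abs_of_pos h1l, div_le_iff₀ h1l]
  have h0 : 0 ≤ remainderTerm n / (4 * π * remainderPoly n) := le_trans (abs_nonneg _) hr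
  nlinarith [hr, hlam2, h0]

/-- RH-FREE. Polynomial factors are absorbed by `p(n)`: `√(2n+½) ≤ p(n)`, `1 ≤ p(n)` and
`16n² + 300 ≤ p(n)`, so that `poly(n)·r(n) ≤ const·a(n)` is summable (`summable_remainderTerm`).
[cite: ConnesConsani2021, App. F Lemma F.1 (i) (arXiv Lemma 49), arXiv PDF p. 55 (chunk p0035:L81)] -/
theorem remainderPoly_lower (n : ℕ) :
    16 * (n : ℝ) ^ 2 + 300 ≤ remainderPoly n ∧ Real.sqrt (2 * n + 1 / 2) ≤ remainderPoly n := by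
  have hπ := Real.pi_gt_three
  have hs : Real.sqrt (2 * n + 1 / 2) ≤ 2 * n + 1 / 2 + 1 := by
    have h0 : (0 : ℝ) ≤ 2 * n + 1 / 2 := by positivity
    nlinarith [Real.sq_sqrt h0, Real.sqrt_nonneg (2 * (n : ℝ) + 1 / 2)]
  unfold remainderPoly
  constructor <;> nlinarith [Real.pi_pos, mul_nonneg (by positivity : (0:ℝ) ≤ 4 + Real.sqrt 2) (Real.sqrt_nonneg (4 * (n:ℝ) + 1)), (Nat.cast_nonneg n : (0:ℝ) ≤ n)]


/-! ## Discharge of `Wang2010_lemma_2_2` (Sturm comparison with the Legendre polynomial) -/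

/-- RH-FREE. **[Wang 2010, Lemma 2.2] PROVED**: the named fact `Wang2010_lemma_2_2` holds —
`n(n+1) < χ < n(n+1) + (2πλ²)²` for the eigenvalue of every `h_{n,λ}`.  Both inequalities by Sturm's
comparison theorem between the prolate equation and Legendre's equation with the weight `λ² − x²`
(`IsProlateFunction.lt_eigen`, `IsProlateFunction.eigen_lt` of
`Literature/NumberTheory/LFunctions/ProlateEigenvalueLegendreBounds.lean`: the `n + 1` gaps of the
function with the smaller potential force `n + 1` zeros of the other, against the `n` zeros of `P_n` in
`(−1, 1)` resp. of `h_{n,λ}` in `(−λ, λ)`); the printed proof (Wang's Appendix A, p. 825) is the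
Hellmann–Feynman identity `∂_c χ_n^c = 2c ∫ x² (ψ_n^c)² ∈ (0, 2c)` integrated in the bandwidth.
[cite: WangLL2010, Lemma 2.2 eq. (2.6) p. 809] -/
theorem Wang2010_lemma_2_2_holds : Wang2010_lemma_2_2 :=
  fun _lam _n _f _χ hf hχ ↦ ⟨hf.lt_eigen hχ, hf.eigen_lt hχ⟩

/-! ## Discharge of `Wang2010_thm_3_6` (the case `φ = ψ_N^c` as typed): energy identities -/

/-- RH-FREE. **[Wang 2010, (3.26), second identity] with the weight `λ² − x²`**: for `f` twice
differentiable on `[−λ, λ]` (one-sided at the ends) with continuous `f″`, and any real `κ`,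
`∫_{-λ}^{λ} (−(λ²−x²)f″ + 2xf′ + κ²x²f)² = ∫ (λ²−x²)²(f″)² + 2∫ (λ²−x²)(1+κ²x²)(f′)²
  + κ²∫ (κ²x⁴ + 6x² − 2λ²) f²` — one integration of the exact derivative of
`Φ = −2x(λ²−x²)(f′)² − 2κ²x²(λ²−x²)ff′ + 2κ²x(λ²−x²)f²`, `Φ(±λ) = 0` (the case `λ = 1` is
`CC2021_rem_50_identity`). [cite: WangLL2010, eq. (3.26) p. 816] -/
theorem weightedProlate_sq_identity {lam : ℝ} {f f' f'' : ℝ → ℝ} (κ : ℝ) (hlam : 0 ≤ lam)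
    (hf : ∀ x ∈ Icc (-lam) lam, HasDerivWithinAt f (f' x) (Icc (-lam) lam) x)
    (hf' : ∀ x ∈ Icc (-lam) lam, HasDerivWithinAt f' (f'' x) (Icc (-lam) lam) x)
    (hf''c : ContinuousOn f'' (Icc (-lam) lam)) :
    ∫ x in (-lam)..lam, (-(lam ^ 2 - x ^ 2) * f'' x + 2 * x * f' x + κ ^ 2 * x ^ 2 * f x) ^ 2 =
      (∫ x in (-lam)..lam, (lam ^ 2 - x ^ 2) ^ 2 * f'' x ^ 2)
        + 2 * (∫ x in (-lam)..lam, (lam ^ 2 - x ^ 2) * (1 + κ ^ 2 * x ^ 2) * f' x ^ 2)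
        + κ ^ 2 * (∫ x in (-lam)..lam, (κ ^ 2 * x ^ 4 + 6 * x ^ 2 - 2 * lam ^ 2) * f x ^ 2) := by
  have hfc : ContinuousOn f (Icc (-lam) lam) := fun x hx ↦ (hf x hx).continuousWithinAt
  have hf'c : ContinuousOn f' (Icc (-lam) lam) := fun x hx ↦ (hf' x hx).continuousWithinAt
  have hll : -lam ≤ lam := by linarith
  have hI : uIcc (-lam) lam = Icc (-lam) lam := uIcc_of_le hll
  -- the boundary form and its derivative
  set Φ : ℝ → ℝ := fun y ↦ -2 * y * (lam ^ 2 - y ^ 2) * f' y ^ 2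
      - 2 * κ ^ 2 * y ^ 2 * (lam ^ 2 - y ^ 2) * (f y * f' y)
      + 2 * κ ^ 2 * y * (lam ^ 2 - y ^ 2) * f y ^ 2 with hΦ
  set Φ' : ℝ → ℝ := fun y ↦ (-(lam ^ 2 - y ^ 2) * f'' y + 2 * y * f' y + κ ^ 2 * y ^ 2 * f y) ^ 2
      - ((lam ^ 2 - y ^ 2) ^ 2 * f'' y ^ 2
          + 2 * ((lam ^ 2 - y ^ 2) * (1 + κ ^ 2 * y ^ 2) * f' y ^ 2)
          + κ ^ 2 * ((κ ^ 2 * y ^ 4 + 6 * y ^ 2 - 2 * lam ^ 2) * f y ^ 2)) with hΦ'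
  have hderiv : ∀ x ∈ Ioo (-lam) lam, HasDerivAt Φ (Φ' x) x := by
    intro x hx
    have hxI : Icc (-lam) lam ∈ 𝓝 x := Icc_mem_nhds hx.1 hx.2
    have h1 : HasDerivAt f (f' x) x := (hf x (Ioo_subset_Icc_self hx)).hasDerivAt hxI
    have h2 : HasDerivAt f' (f'' x) x := (hf' x (Ioo_subset_Icc_self hx)).hasDerivAt hxI
    have hid : HasDerivAt (fun y : ℝ ↦ y) 1 x := hasDerivAt_id x
    have hp2 : HasDerivAt (fun y : ℝ ↦ y ^ 2) (2 * x) x := by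
      simpa using hasDerivAt_pow 2 x
    have hq : HasDerivAt (fun y : ℝ ↦ lam ^ 2 - y ^ 2) (-(2 * x)) x := hp2.const_sub (lam ^ 2)
    have hA := ((hid.const_mul (-2 : ℝ)).fun_mul hq).fun_mul (h2.fun_pow 2)
    have hB := ((hp2.const_mul (2 * κ ^ 2)).fun_mul hq).fun_mul (h1.fun_mul h2)
    have hC := ((hid.const_mul (2 * κ ^ 2)).fun_mul hq).fun_mul (h1.fun_pow 2)
    have h := (hA.fun_sub hB).fun_add hC
    refine h.congr_deriv ?_
    rw [hΦ']
    norm_num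
    ring
  have hΦc : ContinuousOn Φ (Icc (-lam) lam) := by
    rw [hΦ]
    fun_prop
  have hΦ'c : ContinuousOn Φ' (Icc (-lam) lam) := by
    rw [hΦ']
    fun_prop
  have hint : IntervalIntegrable Φ' volume (-lam) lam := (hI ▸ hΦ'c).intervalIntegrable
  have hFTC : ∫ x in (-lam)..lam, Φ' x = 0 := by
    rw [integral_eq_sub_of_hasDerivAt_of_le hll hΦc hderiv hint, hΦ]
    norm_num
  -- integrability of the pieces
  have i1 : IntervalIntegrable (fun x ↦ (lam ^ 2 - x ^ 2) ^ 2 * f'' x ^ 2) volume (-lam) lam := by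
    apply ContinuousOn.intervalIntegrable; rw [hI]; fun_prop
  have i2 : IntervalIntegrable (fun x ↦ (lam ^ 2 - x ^ 2) * (1 + κ ^ 2 * x ^ 2) * f' x ^ 2)
      volume (-lam) lam := by
    apply ContinuousOn.intervalIntegrable; rw [hI]; fun_prop
  have i3 : IntervalIntegrable (fun x ↦ (κ ^ 2 * x ^ 4 + 6 * x ^ 2 - 2 * lam ^ 2) * f x ^ 2)
      volume (-lam) lam := by
    apply ContinuousOn.intervalIntegrable; rw [hI]; fun_prop
  have hsplit : ∫ x in (-lam)..lam,
      (-(lam ^ 2 - x ^ 2) * f'' x + 2 * x * f' x + κ ^ 2 * x ^ 2 * f x) ^ 2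
      = ∫ x in (-lam)..lam, (((lam ^ 2 - x ^ 2) ^ 2 * f'' x ^ 2
          + 2 * ((lam ^ 2 - x ^ 2) * (1 + κ ^ 2 * x ^ 2) * f' x ^ 2))
          + κ ^ 2 * ((κ ^ 2 * x ^ 4 + 6 * x ^ 2 - 2 * lam ^ 2) * f x ^ 2)) + Φ' x :=
    integral_congr fun x _ ↦ by rw [hΦ']; ring
  rw [hsplit, integral_add ((i1.add (i2.const_mul 2)).add (i3.const_mul _)) hint, hFTC, add_zero,
    integral_add (i1.add (i2.const_mul 2)) (i3.const_mul _), integral_add i1 (i2.const_mul 2),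
    intervalIntegral.integral_const_mul, intervalIntegral.integral_const_mul]

/-- RH-FREE. The derivative package of a tree prolate function on `[−λ, λ]` (the case `λ = 1` is
`hasDerivWithinAt_package`): one-sided derivatives `f′ = derivWithin ψ [−λ,λ]`,
`f″ = derivWithin f′ [−λ,λ]` on the closed interval, `f″` continuous, and on the open interval they
are `deriv ψ`, `deriv (deriv ψ)`. [cite: ConnesConsaniMoscovici2025, §7 eq. (7.5)] -/
theorem hasDerivWithinAt_package_gen {lam : ℝ} {m : ℕ} {ψ : ℝ → ℝ} (hψ : IsProlateFunction lam m ψ) :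
    (∀ x ∈ Icc (-lam) lam,
        HasDerivWithinAt ψ (derivWithin ψ (Icc (-lam) lam) x) (Icc (-lam) lam) x) ∧
      (∀ x ∈ Icc (-lam) lam, HasDerivWithinAt (derivWithin ψ (Icc (-lam) lam))
        (derivWithin (derivWithin ψ (Icc (-lam) lam)) (Icc (-lam) lam) x) (Icc (-lam) lam) x) ∧
      ContinuousOn (derivWithin (derivWithin ψ (Icc (-lam) lam)) (Icc (-lam) lam))
        (Icc (-lam) lam) ∧
      (∀ x ∈ Ioo (-lam) lam, derivWithin ψ (Icc (-lam) lam) x = deriv ψ x) ∧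
      (∀ x ∈ Ioo (-lam) lam,
        derivWithin (derivWithin ψ (Icc (-lam) lam)) (Icc (-lam) lam) x = deriv (deriv ψ) x) := by
  have hU : UniqueDiffOn ℝ (Icc (-lam) lam) := uniqueDiffOn_Icc (by linarith [hψ.lam_pos])
  have h2 : ContDiffOn ℝ 2 ψ (Icc (-lam) lam) := hψ.contDiffOn
  rw [show (2 : WithTop ℕ∞) = 1 + 1 from rfl, contDiffOn_succ_iff_derivWithin hU] at h2
  obtain ⟨hd1, -, h1⟩ := h2
  rw [show (1 : WithTop ℕ∞) = 0 + 1 from rfl, contDiffOn_succ_iff_derivWithin hU] at h1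
  obtain ⟨hd2, -, h0⟩ := h1
  have hIoo : ∀ x ∈ Ioo (-lam) lam, derivWithin ψ (Icc (-lam) lam) x = deriv ψ x := fun x hx ↦
    derivWithin_of_mem_nhds (Icc_mem_nhds hx.1 hx.2)
  refine ⟨fun x hx ↦ (hd1 x hx).hasDerivWithinAt, fun x hx ↦ (hd2 x hx).hasDerivWithinAt,
    h0.continuousOn, hIoo, fun x hx ↦ ?_⟩
  rw [derivWithin_of_mem_nhds (Icc_mem_nhds hx.1 hx.2)]
  refine Filter.EventuallyEq.deriv_eq ?_
  filter_upwards [isOpen_Ioo.mem_nhds hx] with y hy using hIoo y hy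

/-- RH-FREE. **[Wang 2010, (3.26), first identity] for `φ = ψ_N^c`** in tree normalisation: the energy
identity `∫_{-λ}^{λ} (λ²−x²)(ψ′)² = χ − ∫_{-λ}^{λ} (2πλx)² ψ²` for the prolate function `h_{N,λ}` with
eigenvalue `χ` (one integration by parts; the flux `(λ²−x²)ψ′` vanishes at `±λ`).
[cite: WangLL2010, eq. (3.26) p. 816] -/
theorem integral_weight_mul_deriv_sq_eq {lam : ℝ} {m : ℕ} {ψ : ℝ → ℝ} {χ : ℝ}
    (hψ : IsProlateFunction lam m ψ)
    (hχ : ∀ x ∈ Ioo (-lam) lam,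
      -(deriv (fun y ↦ (lam ^ 2 - y ^ 2) * deriv ψ y) x) + (2 * π * lam * x) ^ 2 * ψ x = χ * ψ x) :
    ∫ x in (-lam)..lam, (lam ^ 2 - x ^ 2) * deriv ψ x ^ 2 =
      χ - ∫ x in (-lam)..lam, (2 * π * lam * x) ^ 2 * ψ x ^ 2 := by
  have hlam := hψ.lam_pos
  have hll : -lam ≤ lam := by linarith
  have hI : uIcc (-lam) lam = Icc (-lam) lam := uIcc_of_le hll
  set f₁ : ℝ → ℝ := derivWithin ψ (Icc (-lam) lam) with hf₁
  have hψc : ContinuousOn ψ (Icc (-lam) lam) := hψ.contDiffOn.continuousOn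
  have hf₁c : ContinuousOn f₁ (Icc (-lam) lam) := hψ.continuousOn_derivWithin
  -- the boundary form `Ψ = −(λ²−x²)ψ′·ψ`
  set Ψ : ℝ → ℝ := fun y ↦ -((lam ^ 2 - y ^ 2) * f₁ y * ψ y) with hΨ
  set Ψ' : ℝ → ℝ := fun y ↦ -(((2 * π * lam * y) ^ 2 - χ) * ψ y * ψ y
      + (lam ^ 2 - y ^ 2) * f₁ y * f₁ y) with hΨ'
  have hderiv : ∀ x ∈ Ioo (-lam) lam, HasDerivAt Ψ (Ψ' x) x := by
    intro x hx
    have h := ((hψ.hasDerivAt_flux hχ hx).mul (hψ.hasDerivAt_derivWithin hx)).neg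
    refine h.congr_deriv ?_
    rw [hΨ']
  have hΨc : ContinuousOn Ψ (Icc (-lam) lam) := by
    rw [hΨ]
    exact ((((continuousOn_const).sub (continuousOn_id.pow 2)).mul hf₁c).mul hψc).neg
  have hΨ'c : ContinuousOn Ψ' (Icc (-lam) lam) := by
    rw [hΨ']
    refine ContinuousOn.neg (ContinuousOn.add ?_ ?_)
    · exact ((Continuous.continuousOn (by fun_prop)).mul hψc).mul hψc
    · exact ((((continuousOn_const).sub (continuousOn_id.pow 2)).mul hf₁c).mul hf₁c)
  have hint : IntervalIntegrable Ψ' volume (-lam) lam := (hI ▸ hΨ'c).intervalIntegrable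
  have hFTC : ∫ x in (-lam)..lam, Ψ' x = 0 := by
    rw [integral_eq_sub_of_hasDerivAt_of_le hll hΨc hderiv hint, hΨ]
    norm_num
  -- rewrite the integral of `Ψ'`
  have i1 : IntervalIntegrable (fun x ↦ (2 * π * lam * x) ^ 2 * ψ x ^ 2) volume (-lam) lam := by
    apply ContinuousOn.intervalIntegrable; rw [hI]
    exact (Continuous.continuousOn (by fun_prop)).mul (hψc.pow 2)
  have i2 : IntervalIntegrable (fun x ↦ ψ x ^ 2) volume (-lam) lam := by
    apply ContinuousOn.intervalIntegrable; rw [hI]; exact hψc.pow 2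
  have i3 : IntervalIntegrable (fun x ↦ (lam ^ 2 - x ^ 2) * f₁ x ^ 2) volume (-lam) lam := by
    apply ContinuousOn.intervalIntegrable; rw [hI]
    exact ((continuousOn_const).sub (continuousOn_id.pow 2)).mul (hf₁c.pow 2)
  have hsplit : ∫ x in (-lam)..lam, Ψ' x = -((∫ x in (-lam)..lam, (2 * π * lam * x) ^ 2 * ψ x ^ 2)
      - χ * (∫ x in (-lam)..lam, ψ x ^ 2) + ∫ x in (-lam)..lam, (lam ^ 2 - x ^ 2) * f₁ x ^ 2) := by
    rw [← intervalIntegral.integral_const_mul, ← integral_sub i1 (i2.const_mul χ),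
      ← integral_add (i1.sub (i2.const_mul χ)) i3, ← intervalIntegral.integral_neg]
    refine integral_congr fun x _ ↦ ?_
    rw [hΨ']
    ring
  have hnorm : ∫ x in (-lam)..lam, ψ x ^ 2 = 1 := hψ.norm_one
  rw [hsplit, hnorm] at hFTC
  -- `f₁ = deriv ψ` on the open interval, hence a.e. on `Ι (−λ) λ`
  have hae : ∀ᵐ x : ℝ, x ≠ lam := by
    rw [ae_iff]; simp
  have hmem : ∀ x : ℝ, x ∈ Set.uIoc (-lam) lam → x ≠ lam → x ∈ Ioo (-lam) lam := fun x hx h1 ↦ by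
    rw [uIoc_of_le hll] at hx
    exact ⟨hx.1, lt_of_le_of_ne hx.2 h1⟩
  have heq : ∫ x in (-lam)..lam, (lam ^ 2 - x ^ 2) * deriv ψ x ^ 2
      = ∫ x in (-lam)..lam, (lam ^ 2 - x ^ 2) * f₁ x ^ 2 := by
    refine integral_congr_ae ?_
    filter_upwards [hae] with x hx1 hx
    rw [hf₁, derivWithin_of_mem_nhds (Icc_mem_nhds (hmem x hx hx1).1 (hmem x hx hx1).2)]
  rw [heq]
  linarith

/-- RH-FREE. **(3.44) for `φ = ψ_N^c`**: `∫_{-λ}^{λ} (λ²−x²)(ψ′)² ≤ χ` for `h_{N,λ}` with eigenvalue `χ`.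
[cite: WangLL2010, Thm. 3.6 eq. (3.44) p. 820] -/
theorem integral_weight_mul_deriv_sq_le {lam : ℝ} {m : ℕ} {ψ : ℝ → ℝ} {χ : ℝ}
    (hψ : IsProlateFunction lam m ψ)
    (hχ : ∀ x ∈ Ioo (-lam) lam,
      -(deriv (fun y ↦ (lam ^ 2 - y ^ 2) * deriv ψ y) x) + (2 * π * lam * x) ^ 2 * ψ x = χ * ψ x) :
    ∫ x in (-lam)..lam, (lam ^ 2 - x ^ 2) * deriv ψ x ^ 2 ≤ χ := by
  rw [integral_weight_mul_deriv_sq_eq hψ hχ]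
  have h0 : 0 ≤ ∫ x in (-lam)..lam, (2 * π * lam * x) ^ 2 * ψ x ^ 2 :=
    intervalIntegral.integral_nonneg (by linarith [hψ.lam_pos]) fun x _ ↦ by positivity
  linarith

/-- RH-FREE. **(3.45) for `φ = ψ_N^c`**, squared and in tree normalisation:
`∫_{-λ}^{λ} ((λ²−x²)ψ″)² ≤ χ² + 2c²` (`c = 2πλ²`) for `h_{N,λ}` with eigenvalue `χ`: the second
identity of (3.26) with `𝐖ψ = χψ`, `∫ψ² = 1`, the middle term `≥ 0` and
`κ²(κ²x⁴ + 6x² − 2λ²) ≥ −2κ²λ² = −2c²` (`κ = 2πλ`). [cite: WangLL2010, Thm. 3.6 eq. (3.45) p. 820] -/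
theorem integral_weight_mul_deriv_two_sq_le {lam : ℝ} {m : ℕ} {ψ : ℝ → ℝ} {χ : ℝ}
    (hψ : IsProlateFunction lam m ψ)
    (hχ : ∀ x ∈ Ioo (-lam) lam,
      -(deriv (fun y ↦ (lam ^ 2 - y ^ 2) * deriv ψ y) x) + (2 * π * lam * x) ^ 2 * ψ x = χ * ψ x) :
    ∫ x in (-lam)..lam, ((lam ^ 2 - x ^ 2) * deriv (deriv ψ) x) ^ 2 ≤
      χ ^ 2 + 2 * (2 * π * lam ^ 2) ^ 2 := by
  have hlam := hψ.lam_pos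
  have hll : -lam ≤ lam := by linarith
  have hI : uIcc (-lam) lam = Icc (-lam) lam := uIcc_of_le hll
  obtain ⟨hf, hf', hf''c, e1, e2⟩ := hasDerivWithinAt_package_gen hψ
  set f' := derivWithin ψ (Icc (-lam) lam) with hf'def
  set f'' := derivWithin f' (Icc (-lam) lam) with hf''def
  have hψc : ContinuousOn ψ (Icc (-lam) lam) := hψ.contDiffOn.continuousOn
  have hf'c : ContinuousOn f' (Icc (-lam) lam) := fun x hx ↦ (hf' x hx).continuousWithinAt
  have hode := hψ.ode_of_eigen hχ
  have hae : ∀ᵐ x : ℝ, x ≠ lam := by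
    rw [ae_iff]; simp
  have hmem : ∀ x : ℝ, x ∈ Set.uIoc (-lam) lam → x ≠ lam → x ∈ Ioo (-lam) lam := fun x hx h1 ↦ by
    rw [uIoc_of_le hll] at hx
    exact ⟨hx.1, lt_of_le_of_ne hx.2 h1⟩
  -- `𝐖ψ = χψ` on the open interval, in terms of `f′, f″` (`κ = 2πλ`)
  have hW : ∀ x ∈ Ioo (-lam) lam,
      -(lam ^ 2 - x ^ 2) * f'' x + 2 * x * f' x + (2 * π * lam) ^ 2 * x ^ 2 * ψ x = χ * ψ x := by
    intro x hx
    rw [e1 x hx, e2 x hx]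
    have := hode x hx
    linear_combination (-1 : ℝ) * this
  have hint1 : ∫ x in (-lam)..lam,
      (-(lam ^ 2 - x ^ 2) * f'' x + 2 * x * f' x + (2 * π * lam) ^ 2 * x ^ 2 * ψ x) ^ 2 = χ ^ 2 := by
    have : ∫ x in (-lam)..lam,
        (-(lam ^ 2 - x ^ 2) * f'' x + 2 * x * f' x + (2 * π * lam) ^ 2 * x ^ 2 * ψ x) ^ 2
        = ∫ x in (-lam)..lam, χ ^ 2 * ψ x ^ 2 := by
      refine integral_congr_ae ?_
      filter_upwards [hae] with x hx1 hx
      rw [hW x (hmem x hx hx1)]; ring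
    rw [this, intervalIntegral.integral_const_mul, hψ.norm_one, mul_one]
  have hint2 : ∫ x in (-lam)..lam, ((lam ^ 2 - x ^ 2) * deriv (deriv ψ) x) ^ 2
      = ∫ x in (-lam)..lam, (lam ^ 2 - x ^ 2) ^ 2 * f'' x ^ 2 := by
    refine integral_congr_ae ?_
    filter_upwards [hae] with x hx1 hx
    rw [← e2 x (hmem x hx hx1)]; ring
  have hid := weightedProlate_sq_identity (2 * π * lam) hlam.le hf hf' hf''c
  rw [hint1] at hid
  -- the middle term is `≥ 0`, the last is `≥ −2κ²λ² ∫ψ² = −2c²`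
  have h2 : 0 ≤ ∫ x in (-lam)..lam, (lam ^ 2 - x ^ 2) * (1 + (2 * π * lam) ^ 2 * x ^ 2) * f' x ^ 2 := by
    refine intervalIntegral.integral_nonneg hll fun x hx ↦ ?_
    have : 0 ≤ lam ^ 2 - x ^ 2 := by nlinarith [hx.1, hx.2]
    positivity
  have i3 : IntervalIntegrable
      (fun x ↦ ((2 * π * lam) ^ 2 * x ^ 4 + 6 * x ^ 2 - 2 * lam ^ 2) * ψ x ^ 2) volume (-lam) lam := by
    apply ContinuousOn.intervalIntegrable; rw [hI]
    exact (Continuous.continuousOn (by fun_prop)).mul (hψc.pow 2)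
  have i4 : IntervalIntegrable (fun x ↦ ψ x ^ 2) volume (-lam) lam := by
    apply ContinuousOn.intervalIntegrable; rw [hI]; exact hψc.pow 2
  have h3 : 0 ≤ (∫ x in (-lam)..lam, ((2 * π * lam) ^ 2 * x ^ 4 + 6 * x ^ 2 - 2 * lam ^ 2) * ψ x ^ 2)
      + 2 * lam ^ 2 * ∫ x in (-lam)..lam, ψ x ^ 2 := by
    rw [← intervalIntegral.integral_const_mul, ← integral_add i3 (i4.const_mul _)]
    refine intervalIntegral.integral_nonneg hll fun x _ ↦ ?_
    nlinarith [sq_nonneg (x ^ 2 * ψ x), sq_nonneg (x * ψ x), sq_nonneg (2 * π * lam)]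
  rw [hψ.norm_one] at h3
  rw [hint2]
  nlinarith [sq_nonneg (2 * π * lam), mul_nonneg (sq_nonneg (2 * π * lam)) h3]

/-- RH-FREE. The closing arithmetic of [Wang 2010, Thm 3.6] for `φ = ψ_N^c`: from
`N(N+1) < χ < N(N+1) + c²` (Lemma 2.2) and `c > 0`, `χ ≤ (N + 2c + 1)²` and
`χ² + 2c² ≤ (N² + (3c+1)N + 3(c+1)²)²`. [cite: WangLL2010, Thm. 3.6 eqs. (3.44)–(3.45) p. 820] -/
theorem wang36_arith {N χ c : ℝ} (hN : 0 ≤ N) (hc : 0 < c) (h1 : N * (N + 1) < χ)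
    (h2 : χ < N * (N + 1) + c ^ 2) :
    χ ≤ (N + 2 * c + 1) ^ 2 ∧ χ ^ 2 + 2 * c ^ 2 ≤ (N ^ 2 + (3 * c + 1) * N + 3 * (c + 1) ^ 2) ^ 2 := by
  have hχ0 : 0 < χ := lt_of_le_of_lt (by positivity) h1
  constructor
  · nlinarith [mul_nonneg hN hc.le]
  · have hM0 : 0 ≤ N * (N + 1) + c ^ 2 := by positivity
    have hχM : χ ^ 2 ≤ (N * (N + 1) + c ^ 2) ^ 2 := by nlinarith
    have hs : N ^ 2 + (3 * c + 1) * N + 3 * (c + 1) ^ 2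
        = (N * (N + 1) + c ^ 2) + (3 * c * N + 2 * c ^ 2 + 6 * c + 3) := by ring
    have hs0 : 2 * c ^ 2 + 3 ≤ 3 * c * N + 2 * c ^ 2 + 6 * c + 3 := by nlinarith [mul_nonneg hc.le hN]
    have hsq : (2 * c ^ 2 + 3) ^ 2 ≤ (3 * c * N + 2 * c ^ 2 + 6 * c + 3) ^ 2 :=
      pow_le_pow_left₀ (by positivity) hs0 2
    rw [hs]
    nlinarith [mul_nonneg hM0 (le_trans (by positivity : (0:ℝ) ≤ 2 * c ^ 2 + 3) hs0)]

/-- RH-FREE. **[Wang 2010, Theorem 3.6, eq. (3.43)] for `φ = ψ_N^c` from Lemma 2.2**: the named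
fact `Wang2010_thm_3_6` follows from `Wang2010_lemma_2_2` by the two energy identities (3.26)
(`integral_weight_mul_deriv_sq_le`, `integral_weight_mul_deriv_two_sq_le`) — exactly the printed proof
((3.42) at `r = 1, 2` for a single eigenfunction, then (3.44)–(3.45)).
[cite: WangLL2010, Thm. 3.6 eq. (3.43) p. 820] -/
theorem Wang2010_thm_3_6_of_lemma_2_2 (hW2 : Wang2010_lemma_2_2) : Wang2010_thm_3_6 := by
  intro lam N f hf
  obtain ⟨χ, hχ⟩ := hf.eigen
  obtain ⟨h1, h2⟩ := hW2 lam N f χ hf hχ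
  have hc : 0 < 2 * π * lam ^ 2 := by have := hf.lam_pos; positivity
  obtain ⟨hA, hB⟩ := wang36_arith (N.cast_nonneg) hc h1 h2
  exact ⟨(integral_weight_mul_deriv_sq_le hf hχ).trans hA,
    (integral_weight_mul_deriv_two_sq_le hf hχ).trans hB⟩

/-- RH-FREE. **[Wang 2010, Theorem 3.6, eq. (3.43)] (case `φ = ψ_N^c`, as typed) PROVED**: the named fact
`Wang2010_thm_3_6` holds. [cite: WangLL2010, Thm. 3.6 eq. (3.43) p. 820] -/
theorem Wang2010_thm_3_6_holds : Wang2010_thm_3_6 :=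
  Wang2010_thm_3_6_of_lemma_2_2 Wang2010_lemma_2_2_holds

/-- RH-FREE. The two Wang inputs of `IsAppEProlateDatum` (App. F p0035:L35–L39: (boundWang) and
`2n(2n+1) < χ < 2n(2n+1) + 4π²`), now FACT-FREE: both named facts are discharged above.
[cite: ConnesConsani2021, App. F, chunk p0035:L35–L39] -/
theorem IsAppEProlateDatum.wang_inputs {n : ℕ} {ψ : ℝ → ℝ} {χ : ℝ}
    (hψ : IsProlateFunction 1 (2 * n) ψ)
    (hχ : ∀ x ∈ Ioo (-1 : ℝ) 1,
      -(deriv (fun y ↦ (1 ^ 2 - y ^ 2) * deriv ψ y) x) + (2 * π * 1 * x) ^ 2 * ψ x = χ * ψ x) :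
    (2 * (n : ℝ) * (2 * n + 1) < χ ∧ χ < 2 * (n : ℝ) * (2 * n + 1) + (2 * π) ^ 2) ∧
      ∫ x in (-1 : ℝ)..1, ((1 - x ^ 2) * deriv (deriv ψ) x) ^ 2
        ≤ ((2 * (n : ℝ)) ^ 2 + (6 * π + 1) * (2 * n) + 3 * (2 * π + 1) ^ 2) ^ 2 :=
  IsAppEProlateDatum.wang_inputs_of Wang2010_lemma_2_2_holds Wang2010_thm_3_6_holds hψ hχ

end Literature.NumberTheory.ConnesConsani2021
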